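import Literature.NumberTheory.EllipticCurves.PeriodRationality
import Literature.NumberTheory.EllipticCurves.HeckeOperatorsProofs
import Literature.NumberTheory.EllipticCurves.Gamma1NewformLSeriesProofs
import Literature.NumberTheory.EllipticCurves.ModularSymbolsLattice
import Literature.NumberTheory.EllipticCurves.NewformsCoeffFieldProofs
import Literature.NumberTheory.EllipticCurves.EichlerShimuraPeriodsRankProofs
import Literature.NumberTheory.EllipticCurves.EichlerShimuraPeriodsGamma1CuspMomentsProofs
import Literature.NumberTheory.EllipticCurves.NewformsCoeffFieldLatticeHigherWeightProofs
import Literature.NumberTheory.EllipticCurves.NewformPeriodsCoeffField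
import Literature.NumberTheory.EllipticCurves.EichlerShimuraPeriodsGamma1EpsConjProofs
import Literature.NumberTheory.EllipticCurves.NewformsHeckeProofs
import Literature.NumberTheory.EllipticCurves.HeckeIntegralityProofs
import HarnessLib

/-!
# Rationality of critical values (Paşol–Popa 2013, Prop. 5.11 / Cor. 5.12): proofs —
# the degenerate weights, weight two, and the critical values as moments of `{0, ∞}`

Sibling proof file of `Literature/NumberTheory/EllipticCurves/PeriodRationality.lean`, working
towards `PasolPopa2013_criticalValuesRationality` (V. Paşol, A. A. Popa, *Modular forms and period
polynomials*, Proc. LMS 107 (2013), §5.3, Prop. 5.11 (b),(c) and Cor. 5.12 [PasolPopa2013]).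
The named fact quantifies over all weights `k ∈ ℤ`; this file settles every weight except the
even weights `k ≥ 4` and records the reduction:

* `PasolPopa2013_conclusion_of_not_four_le_or_odd` — for a newform `f ∈ S_k(Γ₀(N))` with `k < 4`
  or `k` odd the conclusion of the fact holds. For `k` odd or `k ≤ 0` there is no newform at all
  (`eq_zero_of_odd_weight_gamma0`, `cuspForm_eq_zero_of_weight_nonpos` of
  `NewformsCoeffFieldProofs`), contradicting `a₁(f) = 1`. For `k = 2` the only critical value is `Λ(1, f)`
  (of parity `+`), and the periods `ω⁺ = iΛ(1,f)` (or `i` if `Λ(1,f) = 0`),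
  `ω⁻ = conj(2πi (f,f) / ω⁺)` do the job: `Λ(1, f) = ∫₀^∞ f(it) dt` is **real** when `f` has
  real Fourier coefficients (`completedLValue_im_eq_zero`: on the imaginary axis
  `f(it) = ∑ aₙ e^{-2πnt}`), and `(f,f)` is real and positive
  (`peterssonProduct_conj_symm_holds`, `peterssonProduct_self_pos_holds`). This is exactly
  Paşol–Popa's normalisation `ω_f^+ \overline{ω_f^-} = i(2π)^{k-1}(f,f)` of Prop. 5.11(b)
  ("if `k` is even one can choose `ω_f^±` such that …", p. 727) in the case where `ρ_f^-(I)` carries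
  no critical value.
* `PasolPopa2013_criticalValuesRationality_iff_even_four_le` — the fact is equivalent to its
  restriction to even weights `k ≥ 4` (the case of Manin's periods theorem proper, whose part (b)
  is Haberland's formula, PP Thm. 3.3).
* (section `Mellin`, weight `n + 2`) `integrableOn_mellin` — the Mellin integrals
  `∫₀^∞ f(is) sᵐ ds` defining `completedLValue` converge absolutely for every cusp form on `Γ₀(N)`;
  `periodFn_S` — the Eichler–Shimura period of `f` at `S` is the generating polynomial of the
  critical values, `c_f(S)(u,v) = -∑ⱼ C(n,j) i^{j+1} Λ(j+1,f) uʲ vⁿ⁻ʲ` (PP eq. (5.7),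
  `r_{I,j}(f) = i^{j+1}Λ(j+1, f)`); `msymbMoment_one_apply` — the moments of the weight-`k`
  M-symbol `{0, ∞}` of `EichlerShimuraPeriodsRankProofs` are `μⱼ(1)(f) = i^{j+1} Λ(j+1, f)`.
* (sections `EpsConj`, `KStructure`, `RealStructure`, `Periods`, even weight `n + 2 ≥ 4`) the
  dual form of Prop. 5.11(a),(c): `periodFn_epsConj0` (conjugation symmetry of the period cocycle on
  `Γ₀(N)`), `IsNewform0.exists_submodule_coeffField_cuspidalLatticeK` (the cuspidal period values
  of a newform lie in a `K_f`-plane: the rank count `PeriodRank.exists_submodule_finrank_le_two_of_real`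
  of `NewformPeriodsCoeffField` over the full Hecke-stable cuspidal lattice of
  `NewformsCoeffFieldLatticeHigherWeightProofs`, with multiplicity one),
  `span_cuspidalLatticeK_eq_map_ker` (`ℚC = Ψ(ker δ)`), `msymbMoment_one_mem_span_cuspidalLatticeK`
  (the inner moments of `{0,∞}` are rational cuspidal classes), `exists_re_im_of_conj_stable`
  (real structure), `IsNewform0.exists_re_im_mem_span_cuspidalLatticeK` (periods `Ω^± ∈ ℝ`).
* (section `CriticalValues`) `IsNewform0.exists_periods_criticalValues` and
  `IsNewform0.innerCriticalValues_mem_coeffField` — **Cor. 5.12 with Prop. 5.11(c) for even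
  `k ≥ 4` at all critical points `1 < n' < k - 1`** (which includes every critical point of the
  parity `(-1)^{n'} = -(-1)^{k-1}`).
* (section `HeckeAtS`) Manin's coefficient theorem for the two extreme critical values:
  `exists_gamma0_S_upper_eq_heckeRep_mul_S` (`βᵢ S = γᵢ S Uᵢ`, `γᵢ ∈ Γ₀(N)`, `Uᵢ` parabolic),
  `periodFn_heckeT_S` (`c_{T_p f}(S)(q) = ∑ᵢ c_f(γᵢS)(Uᵢq)`),
  `dualMap_heckeT_periodFnDual_S_sub_mem` (`T_p^∨ λ_{S,q} - (1 + p^{n+1}) λ_{S,q} ∈ Ψ(ker δ)`: the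
  Eisenstein eigenvalue `1 + p^{k-1}` on the boundary at the cusps `0`, `∞`),
  `exists_prime_cuspCoeff_ne_eisenstein` (Hecke's bound, Mathlib `CuspFormClass.qExpansion_isBigO`).
* (section `Extremes`) `IsNewform0.periodFn_S_mem_span`, `IsNewform0.exists_periods_criticalValues'`
  and **`IsNewform0.criticalValues_mem_coeffField` — Cor. 5.12 with Prop. 5.11(c) for every newform
  of even weight `k ≥ 4` at every critical point `0 < n' < k`**; and the reduction
  `PasolPopa2013_criticalValuesRationality_of_partB`: the named fact now follows from Prop. 5.11(b)
  alone (Haberland's formula `3C_k (f,f) = {ρ_f^+, \overline{ρ_f^-}}`, PP Thm. 3.3, proved there by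
  Stokes' theorem on a fundamental domain — not available in Mathlib or the tree).

## References

* [PasolPopa2013] V. Paşol, A. A. Popa, Proc. LMS 107 (2013) 713–743 = arXiv:1202.5802: §5.3,
  Prop. 5.11, eq. (5.7), Cor. 5.12; §3, Thm. 3.2–3.3.
* [Manin1973] Ju. I. Manin, *Periods of parabolic forms and p-adic Hecke series*, Thm. 1.3.
-/

noncomputable section

open scoped MatrixGroups ModularForm ComplexConjugate
open CongruenceSubgroup MeasureTheory
open UpperHalfPlane hiding I

namespace Literature.NumberTheory.EllipticCurves.ModularForms

/-! ### Newforms only exist in even weight `≥ 2` -/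

section Weights

variable {N : ℕ} [NeZero N] {k : ℤ}

/-- There are no newforms of weight `k ≤ 0` or of odd weight on `Γ₀(N)` (`a₁(f) = 1` forces
`f ≠ 0`). [folklore] -/
theorem IsNewform0.even_and_two_le {f : CuspForm (Gamma0 N) k} (hf : IsNewform0 f) :
    Even k ∧ 2 ≤ k := by
  have hf0 : f ≠ 0 := IsNormalized.ne_zero hf.2.2
  have heven : Even k := by
    by_contra hodd
    rw [Int.not_even_iff_odd] at hodd
    exact hf0 (eq_zero_of_odd_weight_gamma0 N hodd f)
  refine ⟨heven, ?_⟩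
  by_contra hlt
  push Not at hlt
  obtain ⟨m, rfl⟩ := heven
  have hk : m + m ≤ 0 := by omega
  exact hf0 (cuspForm_eq_zero_of_weight_nonpos hk f)

end Weights

/-! ### Weight two: `Λ(1, f)` is real for real coefficients; the Petersson norm is real -/

section WeightTwo

variable {N : ℕ} [NeZero N] {k : ℤ}

/-- On the imaginary axis a cusp form on `Γ₀(N)` with real Fourier coefficients is real:
`f(it) = ∑ aₙ e^{-2πnt}`. [folklore] -/
theorem im_apply_ofComplex_mul_I_eq_zero (f : CuspForm (Gamma0 N) k) (hf : HasRealCoefficients f)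
    {t : ℝ} (ht : 0 < t) : (f (ofComplex ((t : ℂ) * Complex.I))).im = 0 := by
  set z : ℍ := ofComplex ((t : ℂ) * Complex.I) with hz
  have hzt : (z : ℂ) = (t : ℂ) * Complex.I := by
    rw [hz, ofComplex_apply_of_im_pos (by simpa using ht)]
  have hq : Function.Periodic.qParam 1 (z : ℂ) = (Real.exp (-(2 * Real.pi * t)) : ℂ) := by
    rw [Function.Periodic.qParam, hzt, Complex.ofReal_exp]
    congr 1
    push_cast
    ring_nf
    rw [Complex.I_sq]
    ring
  have hsum := hasSum_qExpansion_gamma0 N k f z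
  have him := (Complex.hasSum_iff _ _).mp hsum |>.2
  have h0 : (fun m : ℕ ↦ ((qExpansion 1 ⇑f).coeff m • Function.Periodic.qParam 1 (z : ℂ) ^ m).im) =
      fun _ ↦ 0 := by
    funext m
    rw [hq, ← Complex.ofReal_pow, smul_eq_mul, Complex.mul_im, Complex.ofReal_re,
      Complex.ofReal_im, hf m]
    ring
  rw [h0] at him
  simpa using (hasSum_zero.unique him).symm

/-- **`Λ(1, f)` — indeed every `∫₀^∞ f(it) t^{n-1} dt` — is real for a cusp form with real
Fourier coefficients** (Paşol–Popa, proof of Prop. 5.11(c) via (2.1)). [cite: PasolPopa2013, Prop. 5.11(c)] -/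
theorem completedLValue_im_eq_zero (f : CuspForm (Gamma0 N) k) (hf : HasRealCoefficients f)
    (n : ℕ) : (completedLValue f n).im = 0 := by
  rw [completedLValue]
  have h : ∫ t in Set.Ioi (0 : ℝ), ((t : ℂ) ^ (n - 1)) * f (ofComplex ((t : ℂ) * Complex.I)) =
      ∫ t in Set.Ioi (0 : ℝ), ((t ^ (n - 1) * (f (ofComplex ((t : ℂ) * Complex.I))).re : ℝ) : ℂ) := by
    refine setIntegral_congr_fun measurableSet_Ioi fun t ht ↦ ?_
    have hre : f (ofComplex ((t : ℂ) * Complex.I)) =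
        ((f (ofComplex ((t : ℂ) * Complex.I))).re : ℂ) := by
      conv_lhs => rw [← Complex.re_add_im (f (ofComplex ((t : ℂ) * Complex.I)))]
      rw [im_apply_ofComplex_mul_I_eq_zero f hf ht]
      simp
    rw [Complex.ofReal_mul, Complex.ofReal_pow, ← hre]
  rw [h, integral_complex_ofReal, Complex.ofReal_im]

/-- The Petersson norm `(f, f)` of a cusp form is real (Hermitian symmetry,
`peterssonProduct_conj_symm_holds`). [folklore] -/
theorem peterssonProduct_self_im_eq_zero (Γ : Subgroup (GL (Fin 2) ℝ)) [Γ.IsArithmetic]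
    [Γ.HasDetOne] (k : ℤ) (f : CuspForm Γ k) : (peterssonProduct Γ k f f).im = 0 := by
  have h := peterssonProduct_conj_symm_holds Γ k f f
  exact Complex.conj_eq_iff_im.mp h.symm

/-- The Petersson norm of a cusp form is the real number `re (f, f)`. [folklore] -/
theorem peterssonProduct_self_eq_ofReal (Γ : Subgroup (GL (Fin 2) ℝ)) [Γ.IsArithmetic]
    [Γ.HasDetOne] (k : ℤ) (f : CuspForm Γ k) :
    peterssonProduct Γ k f f = ((peterssonProduct Γ k f f).re : ℂ) :=
  Complex.ext (by simp) (by simp [peterssonProduct_self_im_eq_zero Γ k f])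

/-- **Paşol–Popa Prop. 5.11 (b),(c) with Cor. 5.12 in weight `2`.** For a newform
`f ∈ S₂(Γ₀(N))` the only critical value is `Λ(1, f)` (parity `(-1)¹ = (-1)^{k-1}`, period `ω⁺`);
with `ω⁺ = iΛ(1, f)` (`ω⁺ = i` if `Λ(1, f) = 0`) and `ω⁻ = \overline{2πi (f,f)/ω⁺}` one has
`iΛ(1,f)/ω⁺ ∈ {0, 1} ⊆ K_f`, `ω⁺ \overline{ω⁻} = i (2π) (f,f)`, and, for real coefficients,
`ω⁺ ∈ iℝ = i³ℝ`, `ω⁻ ∈ ℝ = i²ℝ` since `Λ(1,f)` and `(f,f) > 0` are real. [cite: PasolPopa2013, Prop. 5.11 (b),(c) and Cor. 5.12 (k = 2)] -/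
theorem PasolPopa2013_conclusion_weight_two (N : ℕ) [NeZero N] (f : CuspForm (Gamma0 N) 2)
    (hf : IsNewform0 f) :
    ∃ ωp ωm : ℂ, ωp ≠ 0 ∧ ωm ≠ 0 ∧
      (∀ n : ℕ, 0 < n → (n : ℤ) < 2 →
        ((n : ℤ).negOnePow = ((2 : ℤ) - 1).negOnePow →
          Complex.I ^ n * completedLValue f n / ωp ∈ coeffField f) ∧
        ((n : ℤ).negOnePow = -((2 : ℤ) - 1).negOnePow →
          Complex.I ^ n * completedLValue f n / ωm ∈ coeffField f)) ∧
      (Even (2 : ℤ) → ωp * (starRingEnd ℂ) ωm /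
          (Complex.I * (2 * Real.pi : ℂ) ^ ((2 : ℤ) - 1) * peterssonProduct (Gamma0 N) 2 f f) ∈
        coeffField f) ∧
      (Odd (2 : ℤ) →
        ((‖ωp‖ ^ 2 : ℝ) : ℂ) / ((2 * Real.pi : ℂ) ^ ((2 : ℤ) - 1) * peterssonProduct (Gamma0 N) 2 f f) ∈
          coeffField f ∧
        ((‖ωm‖ ^ 2 : ℝ) : ℂ) / ((2 * Real.pi : ℂ) ^ ((2 : ℤ) - 1) * peterssonProduct (Gamma0 N) 2 f f) ∈
          coeffField f) ∧
      (HasRealCoefficients f →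
        (∃ r : ℝ, ωp = Complex.I ^ ((2 : ℤ) + 1) * r) ∧ (∃ r : ℝ, ωm = Complex.I ^ (2 : ℤ) * r)) := by
  classical
  have hf0 : f ≠ 0 := IsNormalized.ne_zero hf.2.2
  set Λ : ℂ := completedLValue f 1 with hΛ
  set P : ℂ := peterssonProduct (Gamma0 N) 2 f f with hP
  have hPpos : 0 < P.re := peterssonProduct_self_pos_holds (Gamma0 N) 2 hf0
  have hPreal : P = (P.re : ℂ) := peterssonProduct_self_eq_ofReal (Gamma0 N) 2 f
  have hP0 : P ≠ 0 := fun h ↦ by simp [h] at hPpos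
  have hπ : (2 * Real.pi : ℂ) ≠ 0 := by
    exact_mod_cast (mul_pos two_pos Real.pi_pos).ne'
  -- the periods
  set ωp : ℂ := if Λ = 0 then Complex.I else Complex.I * Λ with hωp
  have hωp0 : ωp ≠ 0 := by
    rw [hωp]
    split_ifs with h
    · exact Complex.I_ne_zero
    · exact mul_ne_zero Complex.I_ne_zero h
  set ωm : ℂ := (starRingEnd ℂ) (Complex.I * (2 * Real.pi : ℂ) * P / ωp) with hωm
  have hωm0 : ωm ≠ 0 := by
    rw [hωm, map_ne_zero]
    exact div_ne_zero (mul_ne_zero (mul_ne_zero Complex.I_ne_zero hπ) hP0) hωp0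
  have h21 : (2 : ℤ) - 1 = 1 := by norm_num
  refine ⟨ωp, ωm, hωp0, hωm0, fun n hn hn2 ↦ ⟨fun _ ↦ ?_, fun hpar ↦ ?_⟩, fun _ ↦ ?_,
    fun hodd ↦ ?_, fun hreal ↦ ⟨?_, ?_⟩⟩
  · -- the `+` critical value `iΛ(1,f)/ω⁺ ∈ {0,1}`
    obtain rfl : n = 1 := by omega
    simp only [pow_one]
    rw [hωp]
    split_ifs with h
    · rw [← hΛ, h, mul_zero, zero_div]
      exact zero_mem _
    · rw [← hΛ, div_self (mul_ne_zero Complex.I_ne_zero h)]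
      exact one_mem _
  · -- no `-` critical value in weight `2`
    exfalso
    obtain rfl : n = 1 := by omega
    rw [h21] at hpar
    have h1 : ((1 : ℕ) : ℤ).negOnePow = -1 := Int.negOnePow_one
    rw [h1, Int.negOnePow_one, neg_neg] at hpar
    exact absurd (congrArg Units.val hpar) (by norm_num)
  · -- (b): `ω⁺ conj ω⁻ = i 2π (f,f)`
    rw [h21, zpow_one, hωm, starRingEnd_self_apply, mul_div_cancel₀ _ hωp0,
      div_self (mul_ne_zero (mul_ne_zero Complex.I_ne_zero hπ) hP0)]
    exact one_mem _
  · exact absurd hodd (by decide)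
  · -- (c) for `ω⁺`: `Λ(1,f)` is real
    have hΛreal : Λ = (Λ.re : ℂ) := by
      refine Complex.ext (by simp) ?_
      rw [Complex.ofReal_im, hΛ]
      exact completedLValue_im_eq_zero f hreal 1
    have hI3 : Complex.I ^ ((2 : ℤ) + 1) = -Complex.I := by
      rw [show (2 : ℤ) + 1 = 3 by norm_num, zpow_ofNat, pow_succ, Complex.I_sq]
      ring
    rw [hI3, hωp]
    split_ifs with h
    · exact ⟨-1, by push_cast; ring⟩
    · refine ⟨-Λ.re, ?_⟩
      conv_lhs => rw [hΛreal]
      push_cast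
      ring
  · -- (c) for `ω⁻`: `conj (2πi P / ω⁺)` is real as `ω⁺ ∈ iℝ`, `P ∈ ℝ`
    have hΛreal : Λ = (Λ.re : ℂ) := by
      refine Complex.ext (by simp) ?_
      rw [Complex.ofReal_im, hΛ]
      exact completedLValue_im_eq_zero f hreal 1
    have hI2 : Complex.I ^ (2 : ℤ) = -1 := by
      rw [zpow_ofNat, Complex.I_sq]
    -- `ω⁺ = i r` with `r` real nonzero
    obtain ⟨r, hr0, hr⟩ : ∃ r : ℝ, r ≠ 0 ∧ ωp = Complex.I * r := by
      rw [hωp]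
      split_ifs with h
      · exact ⟨1, one_ne_zero, by simp⟩
      · refine ⟨Λ.re, fun h0 ↦ h ?_, ?_⟩
        · rw [hΛreal, h0, Complex.ofReal_zero]
        · conv_lhs => rw [hΛreal]
    refine ⟨-(2 * Real.pi * P.re / r), ?_⟩
    rw [hI2, hωm, hr, hPreal]
    have hr' : (r : ℂ) ≠ 0 := by exact_mod_cast hr0
    have hval : Complex.I * (2 * Real.pi : ℂ) * (P.re : ℂ) / (Complex.I * r) =
        ((2 * Real.pi * P.re / r : ℝ) : ℂ) := by
      push_cast
      field_simp
    rw [hval, Complex.conj_ofReal]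
    push_cast
    simp only [Complex.ofReal_re]
    ring

end WeightTwo

/-! ### Reduction of the fact to even weights `k ≥ 4` -/

section Reduction

/-- **The conclusion of `PasolPopa2013_criticalValuesRationality` in every weight `k < 4` or `k`
odd**: vacuous unless `k = 2` (`IsNewform0.even_and_two_le`), and weight `2` is
`PasolPopa2013_conclusion_weight_two`. [cite: PasolPopa2013, Prop. 5.11 (b),(c) and Cor. 5.12] -/
theorem PasolPopa2013_conclusion_of_lt_four_or_odd (N : ℕ) [NeZero N] (k : ℤ)
    (f : CuspForm (Gamma0 N) k) (hf : IsNewform0 f) (hk : k < 4 ∨ Odd k) :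
    ∃ ωp ωm : ℂ, ωp ≠ 0 ∧ ωm ≠ 0 ∧
      (∀ n : ℕ, 0 < n → (n : ℤ) < k →
        ((n : ℤ).negOnePow = (k - 1).negOnePow →
          Complex.I ^ n * completedLValue f n / ωp ∈ coeffField f) ∧
        ((n : ℤ).negOnePow = -(k - 1).negOnePow →
          Complex.I ^ n * completedLValue f n / ωm ∈ coeffField f)) ∧
      (Even k → ωp * (starRingEnd ℂ) ωm /
          (Complex.I * (2 * Real.pi : ℂ) ^ (k - 1) * peterssonProduct (Gamma0 N) k f f) ∈
        coeffField f) ∧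
      (Odd k →
        ((‖ωp‖ ^ 2 : ℝ) : ℂ) / ((2 * Real.pi : ℂ) ^ (k - 1) * peterssonProduct (Gamma0 N) k f f) ∈
          coeffField f ∧
        ((‖ωm‖ ^ 2 : ℝ) : ℂ) / ((2 * Real.pi : ℂ) ^ (k - 1) * peterssonProduct (Gamma0 N) k f f) ∈
          coeffField f) ∧
      (HasRealCoefficients f →
        (∃ r : ℝ, ωp = Complex.I ^ (k + 1) * r) ∧ (∃ r : ℝ, ωm = Complex.I ^ k * r)) := by
  obtain ⟨heven, h2⟩ := hf.even_and_two_le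
  have hk2 : k = 2 := by
    rcases hk with hk | hodd
    · obtain ⟨m, rfl⟩ := heven
      omega
    · exact absurd hodd (Int.not_odd_iff_even.mpr heven)
  subst hk2
  exact PasolPopa2013_conclusion_weight_two N f hf

/-- **Reduction.** `PasolPopa2013_criticalValuesRationality` is equivalent to its restriction to
newforms of even weight `k ≥ 4` — the range of Manin's periods theorem proper (PP Prop. 5.11 /
Cor. 5.12 with part (b) = Haberland's formula, PP Thm. 3.3); all other weights are settled by
`PasolPopa2013_conclusion_of_lt_four_or_odd`. [cite: PasolPopa2013, Prop. 5.11 (b),(c) and Cor. 5.12] -/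
theorem PasolPopa2013_criticalValuesRationality_iff_even_four_le :
    PasolPopa2013_criticalValuesRationality ↔
    ∀ (N : ℕ) [NeZero N] (k : ℤ) (f : CuspForm (Gamma0 N) k), IsNewform0 f → Even k → 4 ≤ k →
    ∃ ωp ωm : ℂ, ωp ≠ 0 ∧ ωm ≠ 0 ∧
      (∀ n : ℕ, 0 < n → (n : ℤ) < k →
        ((n : ℤ).negOnePow = (k - 1).negOnePow →
          Complex.I ^ n * completedLValue f n / ωp ∈ coeffField f) ∧
        ((n : ℤ).negOnePow = -(k - 1).negOnePow →
          Complex.I ^ n * completedLValue f n / ωm ∈ coeffField f)) ∧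
      (Even k → ωp * (starRingEnd ℂ) ωm /
          (Complex.I * (2 * Real.pi : ℂ) ^ (k - 1) * peterssonProduct (Gamma0 N) k f f) ∈
        coeffField f) ∧
      (Odd k →
        ((‖ωp‖ ^ 2 : ℝ) : ℂ) / ((2 * Real.pi : ℂ) ^ (k - 1) * peterssonProduct (Gamma0 N) k f f) ∈
          coeffField f ∧
        ((‖ωm‖ ^ 2 : ℝ) : ℂ) / ((2 * Real.pi : ℂ) ^ (k - 1) * peterssonProduct (Gamma0 N) k f f) ∈
          coeffField f) ∧
      (HasRealCoefficients f →
        (∃ r : ℝ, ωp = Complex.I ^ (k + 1) * r) ∧ (∃ r : ℝ, ωm = Complex.I ^ k * r)) := by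
  constructor
  · intro h N _ k f hf _ _
    exact h N k f hf
  · intro h N _ k f hf
    by_cases hk : k < 4 ∨ Odd k
    · exact PasolPopa2013_conclusion_of_lt_four_or_odd N k f hf hk
    · push Not at hk
      exact h N k f hf (Int.not_odd_iff_even.mp hk.2) hk.1

end Reduction

/-! ### The critical values as moments of the modular symbol `{0, ∞}` -/

section Mellin

open Complex Set Filter Topology ModularGroup

variable {N : ℕ} [NeZero N] {n : ℕ}

/-- `S • (iy) = i/y` for `y > 0`. [folklore] -/
theorem S_smul_ofComplex_mul_I {y : ℝ} (hy : 0 < y) :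
    ModularGroup.S • ofComplex ((y : ℂ) * I) = ofComplex (((y⁻¹ : ℝ) : ℂ) * I) := by
  have h1 : 0 < ((y : ℂ) * I).im := by simpa using hy
  have h2 : 0 < ((((y⁻¹ : ℝ)) : ℂ) * I).im := by simpa using hy
  apply UpperHalfPlane.ext
  rw [modular_S_smul, coe_mk, coe_ofComplex h1, coe_ofComplex h2]
  have hy' : (y : ℂ) ≠ 0 := by exact_mod_cast hy.ne'
  symm
  apply eq_inv_of_mul_eq_one_left
  push_cast
  calc (y : ℂ)⁻¹ * I * -((y : ℂ) * I) = -(((y : ℂ)⁻¹ * y) * (I * I)) := by ring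
    _ = 1 := by rw [inv_mul_cancel₀ hy', ← sq, Complex.I_sq]; ring

/-- **`f(is)`, `0 < s ≤ 1`, is bounded** for a cusp form `f ∈ S_{n+2}(Γ₀(N))`: `f(is) =
(f ∣ S)(i/s) (i/s)^{n+2}` and `f ∣ S` decays exponentially up the imaginary axis. [folklore] -/
theorem exists_norm_apply_imag_le (f : CuspForm (Gamma0 N) (n + 2)) :
    ∃ C : ℝ, ∀ s : ℝ, 0 < s → s ≤ 1 → ‖f (ofComplex ((s : ℂ) * I))‖ ≤ C := by
  have hφ : IsCuspFunction N (⇑f ∣[(n + 2 : ℤ)] ModularGroup.S) := isCuspFunction_slash f ModularGroup.S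
  obtain ⟨C, hC0, hC⟩ := hφ.exists_norm_ray_le_of_nonneg UpperHalfPlane.I
  set a : ℝ := 2 * Real.pi / N with ha
  have hapos : 0 < a := by
    have : (0 : ℝ) < N := by exact_mod_cast Nat.pos_of_ne_zero (NeZero.ne N)
    positivity
  refine ⟨C * Real.exp a * ((n + 2).factorial / a ^ (n + 2)), fun s hs hs1 ↦ ?_⟩
  -- the point `w = i/s = i + it`, `t = 1/s - 1 ≥ 0`
  set t : ℝ := s⁻¹ - 1 with ht
  have ht0 : 0 ≤ t := by
    rw [ht, sub_nonneg]
    exact one_le_inv_iff₀.mpr ⟨hs, hs1⟩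
  have hw_eq : ((UpperHalfPlane.I : ℍ) : ℂ) + t * I = (((s⁻¹ : ℝ)) : ℂ) * I := by
    rw [UpperHalfPlane.coe_I, ht]
    push_cast
    ring
  have him : 0 < ((((s⁻¹ : ℝ)) : ℂ) * I).im := by simpa using hs
  set w : ℍ := ofComplex ((((s⁻¹ : ℝ)) : ℂ) * I) with hw
  have hwcoe : (w : ℂ) = (((s⁻¹ : ℝ)) : ℂ) * I := coe_ofComplex him
  have hSw : ModularGroup.S • w = ofComplex ((s : ℂ) * I) := by
    rw [hw, S_smul_ofComplex_mul_I (inv_pos.mpr hs), inv_inv]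
  -- `(f ∣ S)(w) = f(is) w^{-(n+2)}`
  have hslash : (⇑f ∣[(n + 2 : ℤ)] ModularGroup.S) w =
      f (ofComplex ((s : ℂ) * I)) * (w : ℂ) ^ (-(n + 2 : ℤ)) := by
    rw [ModularForm.SL_slash_apply, hSw, denom_S]
  have hw0 : (w : ℂ) ≠ 0 := by
    rw [hwcoe]
    exact mul_ne_zero (by exact_mod_cast (inv_pos.mpr hs).ne') I_ne_zero
  have hf_eq : f (ofComplex ((s : ℂ) * I)) =
      (⇑f ∣[(n + 2 : ℤ)] ModularGroup.S) w * (w : ℂ) ^ ((n + 2 : ℕ) : ℤ) := by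
    rw [hslash, mul_assoc, ← zpow_add₀ hw0]
    push_cast
    ring_nf
    rw [zpow_zero, mul_one]
  -- norms
  have hnw : ‖(w : ℂ)‖ = s⁻¹ := by
    rw [hwcoe, norm_mul, Complex.norm_I, mul_one, Complex.norm_real, Real.norm_of_nonneg]
    exact (inv_pos.mpr hs).le
  have hbound := hC t ht0
  rw [hw_eq] at hbound
  have hexp : Real.exp (-(2 * Real.pi / N) * t) = Real.exp a * Real.exp (-(a * s⁻¹)) := by
    rw [← Real.exp_add, ← ha, ht]
    ring_nf
  -- `e^{-a/s} ≤ (n+2)! (s/a)^{n+2}`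
  have hkey : Real.exp (-(a * s⁻¹)) * s⁻¹ ^ (n + 2) ≤ (n + 2).factorial / a ^ (n + 2) := by
    have hx : 0 ≤ a * s⁻¹ := by positivity
    have h1 := Real.pow_div_factorial_le_exp (a * s⁻¹) hx (n + 2)
    have hfac : (0 : ℝ) < (n + 2).factorial := by exact_mod_cast Nat.factorial_pos _
    have hexppos := Real.exp_pos (a * s⁻¹)
    have hapow : (0 : ℝ) < a ^ (n + 2) := pow_pos hapos _
    rw [div_le_iff₀ hfac] at h1
    calc Real.exp (-(a * s⁻¹)) * s⁻¹ ^ (n + 2)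
        = (a * s⁻¹) ^ (n + 2) / (Real.exp (a * s⁻¹) * a ^ (n + 2)) := by
          rw [Real.exp_neg]
          field_simp
          ring
      _ ≤ (Real.exp (a * s⁻¹) * (n + 2).factorial) / (Real.exp (a * s⁻¹) * a ^ (n + 2)) := by
          gcongr
      _ = (n + 2).factorial / a ^ (n + 2) := by
          field_simp
  calc ‖f (ofComplex ((s : ℂ) * I))‖
      = ‖(⇑f ∣[(n + 2 : ℤ)] ModularGroup.S) w‖ * s⁻¹ ^ (n + 2) := by
        rw [hf_eq, norm_mul, zpow_natCast, norm_pow, hnw]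
    _ ≤ (C * (Real.exp a * Real.exp (-(a * s⁻¹)))) * s⁻¹ ^ (n + 2) := by
        rw [← hexp]; gcongr
    _ = C * Real.exp a * (Real.exp (-(a * s⁻¹)) * s⁻¹ ^ (n + 2)) := by ring
    _ ≤ C * Real.exp a * ((n + 2).factorial / a ^ (n + 2)) := by gcongr

/-- Continuity of `s ↦ f(is)` on `(0, ∞)`. [folklore] -/
theorem continuousOn_apply_imag (f : CuspForm (Gamma0 N) (n + 2)) :
    ContinuousOn (fun s : ℝ ↦ f (ofComplex ((s : ℂ) * I))) (Ioi 0) := by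
  refine (isCuspFunction_one f).continuousOn_comp_ofComplex.comp (by fun_prop) fun s hs ↦ ?_
  simpa using hs

/-- **Absolute convergence of the Mellin integrals `∫₀^∞ f(is) sᵐ ds`** for every `m ≥ 0` and every
cusp form `f ∈ S_{n+2}(Γ₀(N))`: exponential decay at `∞`, boundedness at `0`
(`exists_norm_apply_imag_le`). In particular `completedLValue f (m+1)` is an honest integral. [folklore] -/
theorem integrableOn_mellin (f : CuspForm (Gamma0 N) (n + 2)) (m : ℕ) :
    IntegrableOn (fun s : ℝ ↦ (s : ℂ) ^ m * f (ofComplex ((s : ℂ) * I))) (Ioi 0) := by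
  rw [← Ioc_union_Ioi_eq_Ioi (zero_le_one : (0 : ℝ) ≤ 1)]
  refine IntegrableOn.union ?_ ?_
  · -- `(0, 1]`: bounded and continuous
    obtain ⟨C, hC⟩ := exists_norm_apply_imag_le f
    have hcont : ContinuousOn (fun s : ℝ ↦ (s : ℂ) ^ m * f (ofComplex ((s : ℂ) * I))) (Ioc 0 1) :=
      (ContinuousOn.mul (by fun_prop) (continuousOn_apply_imag f)).mono Ioc_subset_Ioi_self
    refine IntegrableOn.of_bound measure_Ioc_lt_top (hcont.aestronglyMeasurable measurableSet_Ioc)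
      C ?_
    rw [ae_restrict_iff' measurableSet_Ioc]
    refine Eventually.of_forall fun s hs ↦ ?_
    rw [norm_mul, norm_pow, Complex.norm_real, Real.norm_of_nonneg hs.1.le]
    calc s ^ m * ‖f (ofComplex ((s : ℂ) * I))‖ ≤ 1 * C := by
          gcongr
          · exact pow_le_one₀ hs.1.le hs.2
          · exact hC s hs.1 hs.2
      _ = C := one_mul C
  · -- `(1, ∞)`: the ray above `i`
    have hray := (isCuspFunction_one f).integrableOn_ray_mul_pow UpperHalfPlane.I m
    rw [integrableOn_Ioi_iff_integrableOn_Ioi_add (fun s : ℝ ↦ (s : ℂ) ^ m * f (ofComplex ((s : ℂ) * I))) 1]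
    have h2 : IntegrableOn (fun t : ℝ ↦ (I ^ m)⁻¹ * (f (ofComplex (((UpperHalfPlane.I : ℍ) : ℂ) + t * I)) *
        (((UpperHalfPlane.I : ℍ) : ℂ) + t * I) ^ m)) (Ioi 0) := hray.const_mul _
    refine IntegrableOn.congr_fun h2 (fun t _ ↦ ?_) measurableSet_Ioi
    have hpt : ((UpperHalfPlane.I : ℍ) : ℂ) + t * I = ((t + 1 : ℝ) : ℂ) * I := by
      rw [UpperHalfPlane.coe_I]; push_cast; ring
    rw [hpt, mul_pow]
    have hI : (I ^ m)⁻¹ * I ^ m = 1 := inv_mul_cancel₀ (pow_ne_zero _ I_ne_zero)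
    calc (I ^ m)⁻¹ * (f (ofComplex (((t + 1 : ℝ) : ℂ) * I)) * ((((t + 1 : ℝ) : ℂ)) ^ m * I ^ m))
        = ((I ^ m)⁻¹ * I ^ m) * ((((t + 1 : ℝ) : ℂ)) ^ m * f (ofComplex (((t + 1 : ℝ) : ℂ) * I))) := by
          ring
      _ = (((t + 1 : ℝ) : ℂ)) ^ m * f (ofComplex (((t + 1 : ℝ) : ℂ) * I)) := by rw [hI, one_mul]

/-- `∫_{iε}^{i∞} f(z) zʲ dz = i^{j+1} ∫_ε^∞ f(is) sʲ ds`. [folklore] -/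
theorem powPrimitive_ofComplex_mul_I (f : CuspForm (Gamma0 N) (n + 2)) (j : ℕ) {ε : ℝ} (hε : 0 < ε) :
    powPrimitive j ⇑f (ofComplex ((ε : ℂ) * I)) =
      I ^ (j + 1) * ∫ s in Ioi ε, (s : ℂ) ^ j * f (ofComplex ((s : ℂ) * I)) := by
  have him : 0 < ((ε : ℂ) * I).im := by simpa using hε
  rw [(isCuspFunction_one f).powPrimitive_eq_integral j, coe_ofComplex him,
    integral_Ioi_eq_integral_Ioi_add (fun s : ℝ ↦ (s : ℂ) ^ j * f (ofComplex ((s : ℂ) * I))) ε,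
    pow_succ', mul_assoc]
  congr 1
  rw [← integral_const_mul]
  refine setIntegral_congr_fun measurableSet_Ioi fun t _ ↦ ?_
  have : (ε : ℂ) * I + t * I = ((t + ε : ℝ) : ℂ) * I := by push_cast; ring
  rw [this, mul_pow]
  ring

/-- **The period of `f` at `S` is the generating polynomial of the critical values**:
`c_f(S)(u, v) = ∫_0^{i∞} (f∣S)(z)(zv-u)ⁿ dz = -∫_0^{i∞} f(z)(uz + v)ⁿ dz
 = -∑ⱼ C(n,j) i^{j+1} Λ(j+1, f) uʲ vⁿ⁻ʲ` (Paşol–Popa eq. (5.7): `r_{I,j}(f) = i^{j+1}Λ(j+1,f)`). [cite: PasolPopa2013, §5.3 eq. (5.7)] -/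
theorem periodFn_S (f : CuspForm (Gamma0 N) (n + 2)) (p : Fin 2 → ℂ) :
    periodFn n f ModularGroup.S p =
      -∑ j ∈ Finset.range (n + 1), (n.choose j : ℂ) * (I ^ (j + 1) * completedLValue f (j + 1)) *
        p 0 ^ j * p 1 ^ (n - j) := by
  have hφ : IsCuspFunction N (⇑f ∣[(n + 2 : ℤ)] ModularGroup.S) := isCuspFunction_slash f ModularGroup.S
  -- the two kernel terms
  set A : ℝ → ℂ := fun y ↦ eichlerKernel n (⇑f ∣[(n + 2 : ℤ)] ModularGroup.S)
    (ofComplex (((0 : ℝ) : ℂ) + y * I)) p with hA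
  set B : ℝ → ℂ := fun ε ↦ eichlerKernel n ⇑f (ofComplex ((ε : ℂ) * I))
    ((icmat ModularGroup.S).mulVec p) with hB
  have hSp1 : (icmat ModularGroup.S).mulVec p 1 = p 0 := by
    simp [icmat, Matrix.mulVec, dotProduct, Fin.sum_univ_two, ModularGroup.coe_S]
  have hSp0 : (icmat ModularGroup.S).mulVec p 0 = -p 1 := by
    simp [icmat, Matrix.mulVec, dotProduct, Fin.sum_univ_two, ModularGroup.coe_S]
  have key : ∀ ε : ℝ, 0 < ε → periodFn n f ModularGroup.S p = A ε⁻¹ - B ε := by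
    intro ε hε
    rw [periodFn_eq f ModularGroup.S p (ofComplex (((ε⁻¹ : ℝ) : ℂ) * I)), hA, hB]
    simp only [Complex.ofReal_zero, zero_add]
    rw [S_smul_ofComplex_mul_I (inv_pos.mpr hε), inv_inv]
  -- limit of `A(1/ε)`
  have hA0 : Tendsto (fun ε : ℝ ↦ A ε⁻¹) (𝓝[>] 0) (𝓝 0) :=
    (hφ.tendsto_eichlerKernel_atTop 0 p).comp tendsto_inv_nhdsGT_zero
  -- limit of `B(ε)`
  set L : ℂ := ∑ j ∈ Finset.range (n + 1), (n.choose j : ℂ) * (I ^ (j + 1) * completedLValue f (j + 1)) *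
    p 0 ^ j * p 1 ^ (n - j) with hL
  have hBL : Tendsto B (𝓝[>] 0) (𝓝 L) := by
    have hB' : ∀ ε : ℝ, 0 < ε → B ε = ∑ j ∈ Finset.range (n + 1), (n.choose j : ℂ) *
        (I ^ (j + 1) * ∫ s in Ioi ε, (s : ℂ) ^ j * f (ofComplex ((s : ℂ) * I))) *
          p 0 ^ j * p 1 ^ (n - j) := by
      intro ε hε
      rw [hB]
      simp only [eichlerKernel, hSp1, hSp0, neg_neg]
      refine Finset.sum_congr rfl fun j _ ↦ ?_
      rw [powPrimitive_ofComplex_mul_I f j hε]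
    have hlim : Tendsto (fun ε : ℝ ↦ ∑ j ∈ Finset.range (n + 1), (n.choose j : ℂ) *
        (I ^ (j + 1) * ∫ s in Ioi ε, (s : ℂ) ^ j * f (ofComplex ((s : ℂ) * I))) *
          p 0 ^ j * p 1 ^ (n - j)) (𝓝[>] 0) (𝓝 L) := by
      refine tendsto_finsetSum _ fun j _ ↦ ?_
      have h1 := (tendsto_integral_Ioi_of_integrableOn (integrableOn_mellin f j)).const_mul (I ^ (j + 1))
      have h2 : completedLValue f (j + 1) = ∫ s in Ioi (0 : ℝ), (s : ℂ) ^ j * f (ofComplex ((s : ℂ) * I)) := by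
        rw [completedLValue, Nat.add_sub_cancel]
      rw [h2]
      exact ((h1.const_mul _).mul_const _).mul_const _
    refine hlim.congr' ?_
    filter_upwards [self_mem_nhdsWithin] with ε hε
    exact (hB' ε hε).symm
  -- conclude
  have hconst : Tendsto (fun ε : ℝ ↦ A ε⁻¹ - B ε) (𝓝[>] 0) (𝓝 (periodFn n f ModularGroup.S p)) := by
    refine (tendsto_const_nhds (x := periodFn n f ModularGroup.S p)).congr' ?_
    filter_upwards [self_mem_nhdsWithin] with ε hε
    exact key ε hε
  have := tendsto_nhds_unique hconst (hA0.sub hBL)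
  rw [this, zero_sub]

/-- **The moments of the M-symbol `{0, ∞}` are the critical values**: for even `n`,
`μⱼ(1)(f) = ∫₀^{i∞} f(z) zʲ dz = i^{j+1} Λ(j+1, f)` (`0 ≤ j ≤ n`; Paşol–Popa (5.7)). [cite: PasolPopa2013, §5.3 eq. (5.7)] -/
theorem msymbMoment_one_apply (hn : Even n) (f : CuspForm (Gamma0 N) (n + 2)) (j : Fin (n + 1)) :
    msymbMoment n 1 j f = I ^ ((j : ℕ) + 1) * completedLValue f ((j : ℕ) + 1) := by
  have h := eq_of_momPoly_eq (K := ℂ) hn (x := fun j ↦ msymbMoment n (1 : SL(2, ℤ)) j f)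
    (y := fun j : Fin (n + 1) ↦ I ^ ((j : ℕ) + 1) * completedLValue f ((j : ℕ) + 1)) fun p ↦ ?_
  · exact congr_fun h j
  rw [momPoly_msymbMoment, one_mul, periodFn_one, zero_sub, periodFn_S, neg_neg, momPoly_apply,
    Finset.sum_range]
  refine Finset.sum_congr rfl fun j _ ↦ ?_
  simp only [Matrix.cons_val_zero, Matrix.cons_val_one]

end Mellin

/-! ### Conjugation symmetry of the weight-`k` periods on `Γ₀(N)` -/

section EpsConj

open Complex Matrix.SpecialLinearGroup ModularGroup

variable {N : ℕ} [NeZero N] {n : ℕ}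

omit [NeZero N] in
/-- `(f^ε) ∣ γ = (f ∣ γ^ε)^♭` for `f ∈ S_{n+2}(Γ₀(N))` (as `coe_epsConj_slash` for `Γ₁(N)`). [cite: Shimura1971, proof of Thm. 3.48] -/
theorem coe_epsConj0_slash (f : CuspForm (Gamma0 N) (n + 2)) (γ : SL(2, ℤ)) :
    ⇑(epsConj0 f) ∣[(n + 2 : ℤ)] γ = flatConj (⇑f ∣[(n + 2 : ℤ)] (jConj γ)) := by
  rw [coe_epsConj0, ModularForm.SL_slash, ModularForm.SL_slash, ← SlashAction.slash_mul,
    ← slash_J_eq_flatConj _ (n + 2 : ℤ), ← SlashAction.slash_mul]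
  congr 1
  exact J_mul_mapGL γ

omit [NeZero N] in
variable (n) in
/-- **Conjugation symmetry of the Eichler–Shimura period cocycle on `Γ₀(N)`**:
`c_{f^ε}(γ)(u, v) = (-1)^{n+1} \overline{c_f(γ^ε)(-ū, v̄)}` (the `Γ₀(N)`-form of
`periodFn1_epsConj`; Shimura 1971, §8.2). [cite: Shimura1971, §8.2 and proof of Thm. 3.48] -/
theorem periodFn_epsConj0 (f : CuspForm (Gamma0 N) (n + 2)) (γ : SL(2, ℤ)) (q : Fin 2 → ℂ) :
    periodFn n (epsConj0 f) γ q = (-1) ^ (n + 1) * conj (periodFn n f (jConj γ) (flatVec q)) := by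
  have hcoe : (⇑(epsConj0 f) : ℍ → ℂ) = flatConj ⇑f := by
    rw [coe_epsConj0, slash_J_eq_flatConj]
  rw [periodFn, periodFn, coe_epsConj0_slash, eichlerKernel_flatConj, hcoe, eichlerKernel_flatConj,
    J_smul_I, J_smul_sl_smul, J_smul_I, flatVec_icmat_mulVec, map_sub]
  ring

/-- For a form fixed by `ε` (e.g. a newform on `Γ₀(N)`, `IsNewform0.epsConj0_eq`) and even `n`:
`\overline{λ_{γ,q}(f)} = -λ_{γ^ε, q^ε}(f)`, `q^ε = (-q₀, q₁)`. [folklore] -/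
theorem conj_periodFunctionalK_of_epsConj0_eq (hn : Even n) {f : CuspForm (Gamma0 N) (n + 2)}
    (hf : epsConj0 f = f) (γ : Gamma0 N) (q : Fin 2 → ℤ) :
    conj (periodFunctionalK n γ q f) = -periodFunctionalK n (jConj0 γ) (negFstVec q) f := by
  have h := periodFn_epsConj0 n f (jConj0 γ : SL(2, ℤ)) (fun i ↦ ((negFstVec q i : ℤ) : ℂ))
  rw [hf, coe_jConj0, jConj_jConj, flatVec_intCast, negFstVec_negFstVec, (hn.add_one).neg_one_pow]
    at h
  rw [periodFunctionalK_apply, periodFunctionalK_apply, coe_jConj0, h]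
  ring

omit [NeZero N] in
/-- The boundary `∂(γ, q) = q₁ⁿ - (γq)₁ⁿ` is `ε`-invariant. [folklore] -/
theorem bdryInt_epsPair (gq : Gamma0 N × (Fin 2 → ℤ)) :
    bdryInt n (jConj0 gq.1, negFstVec gq.2) = bdryInt n gq := by
  obtain ⟨γ, q⟩ := gq
  simp only [bdryInt, negFstVec_one, coe_jConj0]
  congr 2
  simp [Matrix.mulVec, dotProduct, Fin.sum_univ_two, jConj]

omit [NeZero N] in
/-- The total boundary is `ε`-invariant. [folklore] -/
theorem bdryF_mapDomain_epsPair (x : (Gamma0 N × (Fin 2 → ℤ)) →₀ ℤ) :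
    bdryF n (x.mapDomain fun gq ↦ (jConj0 gq.1, negFstVec gq.2)) = bdryF n x := by
  induction x using Finsupp.induction_linear with
  | zero => simp
  | add x y hx hy => rw [Finsupp.mapDomain_add, map_add, map_add, hx, hy]
  | single gq a => rw [Finsupp.mapDomain_single, bdryF_single, bdryF_single, bdryInt_epsPair]

/-- `(∑ a λ_{ε(γ,q)})(f) = -\overline{(∑ a λ_{γ,q})(f)}` for `f^ε = f`, `n` even. [folklore] -/
theorem genMap_mapDomain_epsPair_apply (hn : Even n) {f : CuspForm (Gamma0 N) (n + 2)}
    (hf : epsConj0 f = f) (x : (Gamma0 N × (Fin 2 → ℤ)) →₀ ℤ) :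
    genMap n (x.mapDomain fun gq ↦ (jConj0 gq.1, negFstVec gq.2)) f = -conj (genMap n x f) := by
  induction x using Finsupp.induction_linear with
  | zero => simp
  | add x y hx hy =>
    rw [Finsupp.mapDomain_add, map_add, map_add, LinearMap.add_apply, LinearMap.add_apply, hx, hy,
      map_add, neg_add]
  | single gq a =>
    rw [Finsupp.mapDomain_single, genMap_single, genMap_single, LinearMap.smul_apply,
      LinearMap.smul_apply, zsmul_eq_mul, zsmul_eq_mul, map_mul, map_intCast,
      conj_periodFunctionalK_of_epsConj0_eq hn hf]
    ring

/-- **The cuspidal period values of an `ε`-fixed form are stable under complex conjugation**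
(even `n`): `\overline{φ(f)} ∈ {ψ(f) : ψ ∈ C}` for `φ ∈ C`. [folklore] -/
theorem conj_mem_cuspidalLatticeK_apply (hn : Even n) {f : CuspForm (Gamma0 N) (n + 2)}
    (hf : epsConj0 f = f) {φ : Module.Dual ℂ (CuspForm (Gamma0 N) (n + 2))}
    (hφ : φ ∈ cuspidalLatticeK (N := N) n) :
    ∃ ψ ∈ cuspidalLatticeK (N := N) n, ψ f = conj (φ f) := by
  obtain ⟨x, hx, rfl⟩ := AddSubgroup.mem_map.mp hφ
  refine ⟨-genMap n (x.mapDomain fun gq ↦ (jConj0 gq.1, negFstVec gq.2)),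
    neg_mem (AddSubgroup.mem_map.mpr ⟨_, ?_, rfl⟩), ?_⟩
  · rw [AddMonoidHom.mem_ker] at hx ⊢
    rw [bdryF_mapDomain_epsPair, hx]
  · rw [LinearMap.neg_apply, genMap_mapDomain_epsPair_apply hn hf, neg_neg]

end EpsConj

/-! ### The `K_f`-structure on the cuspidal period values of a newform of weight `k ≥ 4` -/

section KStructure

open Module Submodule

variable {N : ℕ} [NeZero N] {n : ℕ}

/-- **A `ℤ`-basis of the cuspidal lattice which is an `ℝ`-basis of `S_{n+2}(Γ₀(N))^∨`** (even
`n ≥ 2`): `C` is finitely generated of `ℚ`-rank `≤ 2 dim_ℂ S` and spans `S^∨` over `ℝ`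
(`finrank_span_cuspidalLatticeK_le`, `cuspidalLatticeK_span_real_eq_top`; the full-lattice half of
Eichler–Shimura, Shimura 1971 Thm. 8.4 / (3.5.20), as assembled in
`gamma0_exists_heckeStableLattice_even`). [cite: Shimura1971, Thm. 8.4 and (3.5.20)] -/
theorem exists_basis_cuspidalLatticeK (hn : Even n) (hn0 : n ≠ 0) :
    ∃ b : Module.Basis (Fin (2 * Module.finrank ℂ (CuspForm (Gamma0 N) (n + 2)))) ℝ
        (Module.Dual ℂ (CuspForm (Gamma0 N) (n + 2))),
      (cuspidalLatticeK (N := N) n : Set (Module.Dual ℂ (CuspForm (Gamma0 N) (n + 2)))) =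
        Submodule.span ℤ (Set.range b) := by
  haveI : FiniteDimensional ℂ (CuspForm (Gamma0 N) (n + 2)) :=
    finiteDimensional_cuspForm_gamma0 N (n + 2)
  haveI := finite_span_cuspidalLatticeK (N := N) n hn
  obtain ⟨s, hs⟩ := exists_coe_eq_span_range_of_finrank_span_le (cuspidalLatticeK (N := N) n)
    (cuspidalLatticeK_fg n) (finrank_span_cuspidalLatticeK_le (N := N) n hn hn0)
  have hspan : ⊤ ≤ Submodule.span ℝ (Set.range s) := by
    rw [← cuspidalLatticeK_span_real_eq_top n hn, Submodule.span_le, hs]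
    exact Submodule.span_le_restrictScalars ℤ ℝ _
  have hcard : Fintype.card (Fin (2 * Module.finrank ℂ (CuspForm (Gamma0 N) (n + 2)))) =
      Module.finrank ℝ (Module.Dual ℂ (CuspForm (Gamma0 N) (n + 2))) := by
    rw [Fintype.card_fin, finrank_real_of_complex, Subspace.dual_finrank_eq]
  have hli : LinearIndependent ℝ s := linearIndependent_of_top_le_span_of_card_eq_finrank hspan hcard
  refine ⟨Module.Basis.mk hli hspan, ?_⟩
  rw [Module.Basis.coe_mk, hs]

set_option maxHeartbeats 400000 in
/-- **The cuspidal periods of a newform of weight `n + 2 ≥ 4` span a `K_f`-plane** (Shimura 1977,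
Thm. 1 in the dual form of `NewformPeriodsCoeffField`; Manin 1973 for level one): for a newform
`f ∈ S_{n+2}(Γ₀(N))` with (real) coefficient field `K_f` the values `φ(f)`, `φ ∈ C` (the cuspidal
period lattice), lie in a `K_f`-subspace of `ℂ` of dimension `≤ 2` — the rank count
`PeriodRank.exists_submodule_finrank_le_two_of_real` over the full Hecke-stable lattice `C`
(`exists_basis_cuspidalLatticeK`, `dualMap_heckeT_mem_cuspidalLatticeK`), with `T_p f = a_p f`,
`a_p ∈ K_f` real, and multiplicity one (`mem_span_of_equiv_of_mem_newSubspace0`). [cite: Shimura1977, Thm. 1] -/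
theorem IsNewform0.exists_submodule_coeffField_cuspidalLatticeK (hn : Even n) (hn0 : n ≠ 0)
    {f : CuspForm (Gamma0 N) (n + 2)} (hf : IsNewform0 f) :
    ∃ R : Submodule (coeffField f) ℂ, FiniteDimensional (coeffField f) R ∧
      Module.finrank (coeffField f) R ≤ 2 ∧
      ∀ φ ∈ cuspidalLatticeK (N := N) n, φ f ∈ R := by
  have hf0 : f ≠ 0 := IsNormalized.ne_zero_gamma0 hf.2.2
  obtain ⟨b, hb⟩ := exists_basis_cuspidalLatticeK (N := N) hn hn0
  let P := {p : ℕ // p.Prime ∧ ¬ p ∣ N}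
  let T : P → CuspForm (Gamma0 N) (n + 2) →ₗ[ℂ] CuspForm (Gamma0 N) (n + 2) := fun p ↦
    haveI : NeZero (p : ℕ) := ⟨p.2.1.ne_zero⟩; heckeT (Gamma0 N) (n + 2) p
  have hT : ∀ p : P, ∀ φ ∈ cuspidalLatticeK (N := N) n,
      (T p).dualMap φ ∈ cuspidalLatticeK (N := N) n := fun p φ hφ ↦ by
    haveI : NeZero (p : ℕ) := ⟨p.2.1.ne_zero⟩
    exact dualMap_heckeT_mem_cuspidalLatticeK n p.2.1 hφ
  have hTf : ∀ p : P, T p f = cuspCoeff f p • f := fun p ↦ by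
    haveI : NeZero (p : ℕ) := ⟨p.2.1.ne_zero⟩
    exact hf.heckeT_eq_coeff_smul p.2.1
  have hM1 : ∀ h : CuspForm (Gamma0 N) (n + 2), (∀ p : P, T p h = cuspCoeff f p • h) →
      h ∈ Submodule.span ℂ ({f} : Set (CuspForm (Gamma0 N) (n + 2))) := by
    intro h hh
    refine mem_span_of_equiv_of_mem_newSubspace0 (a := fun p ↦ cuspCoeff f p) hf0 hf.1
      (fun p hp _ ↦ ?_) h (fun p hp hpN ↦ ?_)
    · haveI : NeZero p := ⟨hp.ne_zero⟩
      exact hf.heckeT_eq_coeff_smul hp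
    · exact hh ⟨p, hp, hpN⟩
  obtain ⟨R, hRfin, hR, hsub⟩ := PeriodRank.exists_submodule_finrank_le_two_of_real (coeffField f)
    (fun x ↦ hf.im_eq_zero_of_mem_coeffField x.2) b (cuspidalLatticeK (N := N) n) hb T hT
    (fun p ↦ cuspCoeff f p) (fun p ↦ coeff_mem_coeffField f p) f hf0 hTf hM1
  refine ⟨R, hRfin, hR, fun φ hφ ↦ hsub ⟨φ, hφ, rfl⟩⟩

/-- **The rational cuspidal classes are exactly the images of the boundary-free M-symbols**:
`ℚC = Ψ(ker δ)` (even `n ≥ 2`) — `ℚC ⊆ Ψ(ker δ)` (`cuspidalLatticeK_subset_map_ker`),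
`dim Ψ(ker δ) ≤ 2 dim S` (`finrank_map_ker_bdryKMap_le`) and `dim_ℚ ℚC = 2 dim S` (`C` has a
`ℤ`-basis of `2 dim S` real-independent elements). [cite: Shimura1971, Thm. 8.4 and Prop. 8.6] -/
theorem span_cuspidalLatticeK_eq_map_ker (hn : Even n) (hn0 : n ≠ 0) :
    Submodule.span ℚ (cuspidalLatticeK (N := N) n : Set (Module.Dual ℂ (CuspForm (Gamma0 N) (n + 2)))) =
      (LinearMap.ker (bdryKMap N n)).map (msymbKMap N n) := by
  obtain ⟨b, hb⟩ := exists_basis_cuspidalLatticeK (N := N) hn hn0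
  have hle : Submodule.span ℚ (cuspidalLatticeK (N := N) n :
      Set (Module.Dual ℂ (CuspForm (Gamma0 N) (n + 2)))) ≤
      (LinearMap.ker (bdryKMap N n)).map (msymbKMap N n) :=
    Submodule.span_le.mpr (cuspidalLatticeK_subset_map_ker n hn)
  refine Submodule.eq_of_le_of_finrank_le hle ?_
  refine (finrank_map_ker_bdryKMap_le N n hn hn0).trans ?_
  have hbQ : LinearIndependent ℚ b :=
    b.linearIndependent.restrict_scalars (smul_left_injective ℚ (one_ne_zero : (1 : ℝ) ≠ 0))
  have hsub : Set.range b ⊆ (cuspidalLatticeK (N := N) n : Set _) := by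
    rw [hb]; exact Submodule.subset_span
  haveI : FiniteDimensional ℚ (Submodule.span ℚ (cuspidalLatticeK (N := N) n :
      Set (Module.Dual ℂ (CuspForm (Gamma0 N) (n + 2))))) :=
    Submodule.finiteDimensional_of_le hle
  calc 2 * Module.finrank ℂ (CuspForm (Gamma0 N) (n + 2))
      = Fintype.card (Fin (2 * Module.finrank ℂ (CuspForm (Gamma0 N) (n + 2)))) := (Fintype.card_fin _).symm
    _ = Module.finrank ℚ (Submodule.span ℚ (Set.range b)) := (finrank_span_eq_card hbQ).symm
    _ ≤ Module.finrank ℚ (Submodule.span ℚ (cuspidalLatticeK (N := N) n : Set _)) :=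
        Submodule.finrank_mono (Submodule.span_mono hsub)

/-- **The inner moments of `{0, ∞}` are rational cuspidal classes**: for `0 < j < n` the M-symbol
`e_{[1]} ⊗ eⱼ` has no boundary (`δ(e_x ⊗ v) = vₙ[x⁻¹∞] - v₀[x⁻¹0]`), so its functional
`μⱼ(1) : f ↦ ∫₀^{i∞} f(z) zʲ dz` lies in `Ψ(ker δ) = ℚC`. [folklore] -/
theorem msymbMoment_one_mem_span_cuspidalLatticeK (hn : Even n) (hn0 : n ≠ 0) {j : Fin (n + 1)}
    (hj0 : j ≠ 0) (hjn : j ≠ Fin.last n) :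
    msymbMoment n (1 : SL(2, ℤ)) j ∈ Submodule.span ℚ (cuspidalLatticeK (N := N) n :
      Set (Module.Dual ℂ (CuspForm (Gamma0 N) (n + 2)))) := by
  classical
  rw [span_cuspidalLatticeK_eq_map_ker hn hn0]
  refine ⟨Pi.single ((1 : SL(2, ℤ)) : Gamma0Coset N) (Pi.single j (1 : ℚ)), ?_, ?_⟩
  · change bdryKMap N n _ = 0
    rw [bdryKMap_single, Pi.single_eq_of_ne (Ne.symm hjn), Pi.single_eq_of_ne (Ne.symm hj0)]
    simp
  · rw [msymbKMap_single, Finset.sum_eq_single j (fun i _ hi ↦ by simp [Pi.single_eq_of_ne hi])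
      (by simp), Pi.single_eq_same, one_smul, msymbK_mk, inv_one]

/-- Hence the inner moments of a newform lie in its `K_f`-structure: `μⱼ(1)(f) ∈ span_ℚ C(f)`. [folklore] -/
theorem msymbMoment_one_apply_mem_span (hn : Even n) (hn0 : n ≠ 0) {j : Fin (n + 1)}
    (hj0 : j ≠ 0) (hjn : j ≠ Fin.last n) (K : IntermediateField ℚ ℂ) (f : CuspForm (Gamma0 N) (n + 2)) :
    msymbMoment n (1 : SL(2, ℤ)) j f ∈ Submodule.span K
      ((fun φ : Module.Dual ℂ (CuspForm (Gamma0 N) (n + 2)) ↦ φ f) '' (cuspidalLatticeK (N := N) n)) := by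
  have hmem := msymbMoment_one_mem_span_cuspidalLatticeK (N := N) hn hn0 hj0 hjn
  -- evaluation at `f` is `ℚ`-linear
  let E : Module.Dual ℂ (CuspForm (Gamma0 N) (n + 2)) →ₗ[ℚ] ℂ :=
    (LinearMap.applyₗ (R := ℂ) f).restrictScalars ℚ
  have hE : ∀ φ, E φ = φ f := fun φ ↦ rfl
  have h1 : E (msymbMoment n (1 : SL(2, ℤ)) j) ∈ (Submodule.span ℚ (cuspidalLatticeK (N := N) n :
      Set (Module.Dual ℂ (CuspForm (Gamma0 N) (n + 2))))).map E := Submodule.mem_map_of_mem hmem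
  rw [Submodule.map_span] at h1
  rw [← hE]
  refine Submodule.span_le.mpr ?_ (Submodule.span_subset_span ℚ K _ h1)
  rintro _ ⟨φ, hφ, rfl⟩
  exact Submodule.subset_span ⟨φ, hφ, rfl⟩

end KStructure

/-! ### Real structure: a conjugation-stable `K`-plane in `ℂ` spanning `ℂ` over `ℝ` -/

section RealStructure

open Complex Module Submodule

/-- **Real and imaginary parts of a conjugation-stable `K`-plane.** Let `K ⊆ ℝ` be a real subfield
of `ℂ` and `R₀ ⊆ ℂ` a `K`-subspace of dimension `≤ 2`, stable under complex conjugation and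
spanning `ℂ` over `ℝ`. Then there are real `Ω⁺, Ω⁻ ≠ 0` with `re z ∈ K Ω⁺` and `im z ∈ K Ω⁻` for
every `z ∈ R₀` (`R₀ = re R₀ ⊕ i im R₀`, both summands nonzero, hence `K`-lines). The abstract form
of step 2 of `IsNewform0.exists_re_im_mem_span_periodLattice`. [folklore] -/
theorem exists_re_im_of_conj_stable (K : IntermediateField ℚ ℂ) (hK : ∀ x : K, (x : ℂ).im = 0)
    (R₀ : Submodule K ℂ) [FiniteDimensional K R₀] (hR₀2 : Module.finrank K R₀ ≤ 2)
    (hconj : ∀ z ∈ R₀, conj z ∈ R₀) (hspan : Submodule.span ℝ (R₀ : Set ℂ) = ⊤) :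
    ∃ Ωp Ωm : ℝ, Ωp ≠ 0 ∧ Ωm ≠ 0 ∧
      ∀ z ∈ R₀, (∃ q : ℂ, q ∈ K ∧ ((z.re : ℝ) : ℂ) = q * Ωp) ∧
        (∃ q : ℂ, q ∈ K ∧ ((z.im : ℝ) : ℂ) = q * Ωm) := by
  -- `R₀` contains real and imaginary parts
  have h2K : (2⁻¹ : ℂ) ∈ K := inv_mem (natCast_mem K 2)
  have hre_mem : ∀ z ∈ R₀, ((z.re : ℝ) : ℂ) ∈ R₀ := by
    intro z hz
    have h2 : ((z.re : ℝ) : ℂ) = (⟨2⁻¹, h2K⟩ : K) • (z + conj z) := by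
      rw [IntermediateField.smul_def, smul_eq_mul, Complex.add_conj]
      change ((z.re : ℝ) : ℂ) = 2⁻¹ * (((2 * z.re : ℝ)) : ℂ)
      push_cast
      ring
    rw [h2]
    exact Submodule.smul_mem _ _ (add_mem hz (hconj z hz))
  have him_mem : ∀ z ∈ R₀, ((z.im : ℝ) : ℂ) * I ∈ R₀ := by
    intro z hz
    have h2 : ((z.im : ℝ) : ℂ) * I = (⟨2⁻¹, h2K⟩ : K) • (z - conj z) := by
      rw [IntermediateField.smul_def, smul_eq_mul, Complex.sub_conj]
      change ((z.im : ℝ) : ℂ) * I = 2⁻¹ * ((((2 * z.im : ℝ)) : ℂ) * I)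
      push_cast
      ring
    rw [h2]
    exact Submodule.smul_mem _ _ (sub_mem hz (hconj z hz))
  -- the `K`-linear maps `z ↦ re z`, `z ↦ i im z`
  let reK : ℂ →ₗ[K] ℂ :=
    { toFun := fun z ↦ ((z.re : ℝ) : ℂ)
      map_add' := fun x y ↦ by simp
      map_smul' := fun c z ↦ by
        rw [RingHom.id_apply, IntermediateField.smul_def, IntermediateField.smul_def, smul_eq_mul,
          smul_eq_mul]
        apply Complex.ext <;> simp [hK c] }
  let imK : ℂ →ₗ[K] ℂ :=
    { toFun := fun z ↦ ((z.im : ℝ) : ℂ) * I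
      map_add' := fun x y ↦ by simp only [Complex.add_im, Complex.ofReal_add]; ring
      map_smul' := fun c z ↦ by
        rw [RingHom.id_apply, IntermediateField.smul_def, IntermediateField.smul_def, smul_eq_mul,
          smul_eq_mul]
        apply Complex.ext <;> simp [hK c] }
  have hreK : ∀ z, reK z = ((z.re : ℝ) : ℂ) := fun z ↦ rfl
  have himK : ∀ z, imK z = ((z.im : ℝ) : ℂ) * I := fun z ↦ rfl
  set P : Submodule K ℂ := R₀.map reK with hPdef
  set Q : Submodule K ℂ := R₀.map imK with hQdef
  have hPR : P ≤ R₀ := by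
    rintro _ ⟨z, hz, rfl⟩
    exact hre_mem z hz
  have hQR : Q ≤ R₀ := by
    rintro _ ⟨z, hz, rfl⟩
    exact him_mem z hz
  haveI : FiniteDimensional K P := Submodule.finiteDimensional_of_le hPR
  haveI : FiniteDimensional K Q := Submodule.finiteDimensional_of_le hQR
  have hPim : ∀ x ∈ P, x.im = 0 := by
    rintro _ ⟨z, _, rfl⟩
    simp [hreK]
  have hQre : ∀ x ∈ Q, x.re = 0 := by
    rintro _ ⟨z, _, rfl⟩
    simp [himK]
  have hPQ : P ⊓ Q = ⊥ := by
    rw [eq_bot_iff]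
    intro x hx
    rw [Submodule.mem_bot]
    exact Complex.ext (by simpa using hQre x hx.2) (by simpa using hPim x hx.1)
  have hsum : Module.finrank K P + Module.finrank K Q ≤ 2 := by
    have h := Submodule.finrank_sup_add_finrank_inf_eq P Q
    rw [hPQ, finrank_bot, add_zero] at h
    rw [← h]
    exact (Submodule.finrank_mono (sup_le hPR hQR)).trans hR₀2
  -- both are nonzero, since `R₀` spans `ℂ` over `ℝ`
  have hP0 : P ≠ ⊥ := by
    intro hP
    have hker : Submodule.span ℝ (R₀ : Set ℂ) ≤ LinearMap.ker Complex.reLm := by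
      rw [Submodule.span_le]
      intro z hz
      rw [SetLike.mem_coe, LinearMap.mem_ker, Complex.reLm_coe]
      have hzP : reK z ∈ P := ⟨z, hz, rfl⟩
      rw [hP, Submodule.mem_bot, hreK] at hzP
      exact_mod_cast hzP
    rw [hspan] at hker
    have h1 : (1 : ℂ) ∈ LinearMap.ker Complex.reLm := hker trivial
    simp at h1
  have hQ0 : Q ≠ ⊥ := by
    intro hQ
    have hker : Submodule.span ℝ (R₀ : Set ℂ) ≤ LinearMap.ker Complex.imLm := by
      rw [Submodule.span_le]
      intro z hz
      rw [SetLike.mem_coe, LinearMap.mem_ker, Complex.imLm_coe]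
      have hzQ : imK z ∈ Q := ⟨z, hz, rfl⟩
      rw [hQ, Submodule.mem_bot, himK] at hzQ
      have := mul_eq_zero.mp hzQ
      rcases this with h | h
      · exact_mod_cast h
      · exact absurd h Complex.I_ne_zero
    rw [hspan] at hker
    have h1 : (I : ℂ) ∈ LinearMap.ker Complex.imLm := hker trivial
    simp at h1
  have hP1 : 1 ≤ Module.finrank K P := Submodule.one_le_finrank_iff.mpr hP0
  have hQ1 : 1 ≤ Module.finrank K Q := Submodule.one_le_finrank_iff.mpr hQ0
  have hPeq : Module.finrank K P = 1 := by omega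
  have hQeq : Module.finrank K Q = 1 := by omega
  obtain ⟨v, hv0, hv⟩ := finrank_eq_one_iff'.mp hPeq
  obtain ⟨u, hu0, hu⟩ := finrank_eq_one_iff'.mp hQeq
  -- `v = Ω⁺` is real, `u = i Ω⁻` purely imaginary
  have hvre : (((v : ℂ).re : ℝ) : ℂ) = v := Complex.ext (by simp) (by simp [hPim _ v.2])
  have huim : (((u : ℂ).im : ℝ) : ℂ) * I = u := Complex.ext (by simp [hQre _ u.2]) (by simp)
  refine ⟨(v : ℂ).re, (u : ℂ).im, ?_, ?_, fun z hz ↦ ⟨?_, ?_⟩⟩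
  · intro h
    apply hv0
    exact Subtype.ext (by rw [← hvre, h]; simp)
  · intro h
    apply hu0
    exact Subtype.ext (by rw [← huim, h]; simp)
  · obtain ⟨c, hc⟩ := hv ⟨reK z, ⟨z, hz, rfl⟩⟩
    refine ⟨c, c.2, ?_⟩
    have h := congrArg Subtype.val hc
    simp only [Submodule.coe_smul, IntermediateField.smul_def, smul_eq_mul] at h
    rw [hreK] at h
    rw [← h, hvre]
  · obtain ⟨c, hc⟩ := hu ⟨imK z, ⟨z, hz, rfl⟩⟩
    refine ⟨c, c.2, ?_⟩
    have h := congrArg Subtype.val hc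
    simp only [Submodule.coe_smul, IntermediateField.smul_def, smul_eq_mul] at h
    rw [himK, ← huim, ← mul_assoc] at h
    exact (mul_right_cancel₀ Complex.I_ne_zero h).symm

end RealStructure

/-! ### The periods `Ω^±` of a newform of weight `k ≥ 4` -/

section Periods

open Complex Module Submodule

variable {N : ℕ} [NeZero N] {n : ℕ}

/-- **Shimura's theorem on the cuspidal periods of a newform of weight `n + 2 ≥ 4`** (Shimura 1977,
Thm. 1; Manin 1973, Thm. 1.2 for level one; Paşol–Popa 2013, Prop. 5.11(a),(c) in dual form): there
are real `Ω⁺, Ω⁻ ≠ 0` such that every element of the `K_f`-span of the cuspidal period values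
`{φ(f) : φ ∈ C}` — in particular every inner moment `μⱼ(1)(f) = ∫₀^{i∞} f(z) zʲ dz`, `0 < j < n` —
is `a Ω⁺ + b Ω⁻ i` with `a, b ∈ K_f`. [cite: Shimura1977, Thm. 1] -/
theorem IsNewform0.exists_re_im_mem_span_cuspidalLatticeK (hn : Even n) (hn0 : n ≠ 0)
    {f : CuspForm (Gamma0 N) (n + 2)} (hf : IsNewform0 f) :
    ∃ Ωp Ωm : ℝ, Ωp ≠ 0 ∧ Ωm ≠ 0 ∧
      ∀ z ∈ Submodule.span (coeffField f)
        ((fun φ : Module.Dual ℂ (CuspForm (Gamma0 N) (n + 2)) ↦ φ f) '' (cuspidalLatticeK (N := N) n)),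
        (∃ q : ℂ, q ∈ coeffField f ∧ ((z.re : ℝ) : ℂ) = q * Ωp) ∧
        (∃ q : ℂ, q ∈ coeffField f ∧ ((z.im : ℝ) : ℂ) = q * Ωm) := by
  set K : IntermediateField ℚ ℂ := coeffField f with hKdef
  have hK : ∀ x : K, (x : ℂ).im = 0 := fun x ↦ hf.im_eq_zero_of_mem_coeffField x.2
  have hf0 : f ≠ 0 := IsNormalized.ne_zero_gamma0 hf.2.2
  obtain ⟨R, hRfin, hR2, hCR⟩ := hf.exists_submodule_coeffField_cuspidalLatticeK hn hn0
  set Cf : Set ℂ := (fun φ : Module.Dual ℂ (CuspForm (Gamma0 N) (n + 2)) ↦ φ f) ''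
    (cuspidalLatticeK (N := N) n) with hCf
  set R₀ : Submodule K ℂ := Submodule.span K Cf with hR₀def
  have hR₀R : R₀ ≤ R := by
    rw [hR₀def, Submodule.span_le]
    rintro _ ⟨φ, hφ, rfl⟩
    exact hCR φ hφ
  haveI : FiniteDimensional K R₀ := Submodule.finiteDimensional_of_le hR₀R
  have hR₀2 : Module.finrank K R₀ ≤ 2 := (Submodule.finrank_mono hR₀R).trans hR2
  -- conjugation stability (`f^ε = f`)
  have hconjC : ∀ z ∈ Cf, conj z ∈ Cf := by
    rintro _ ⟨φ, hφ, rfl⟩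
    obtain ⟨ψ, hψ, hψf⟩ := conj_mem_cuspidalLatticeK_apply hn hf.epsConj0_eq hφ
    exact ⟨ψ, hψ, hψf⟩
  have hconj : ∀ z ∈ R₀, conj z ∈ R₀ := by
    intro z hz
    induction hz using Submodule.span_induction with
    | mem x hx => exact Submodule.subset_span (hconjC x hx)
    | zero => rw [map_zero]; exact zero_mem _
    | add x y _ _ hx hy => rw [map_add]; exact add_mem hx hy
    | smul c x _ hx =>
      rw [IntermediateField.smul_def, smul_eq_mul, map_mul, Complex.conj_eq_iff_im.mpr (hK c),
        ← smul_eq_mul, ← IntermediateField.smul_def]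
      exact Submodule.smul_mem _ c hx
  -- `Cf` spans `ℂ` over `ℝ`: `C` spans `S^∨` over `ℝ` and evaluation at `f ≠ 0` is onto
  have hspan : Submodule.span ℝ (R₀ : Set ℂ) = ⊤ := by
    haveI : FiniteDimensional ℂ (CuspForm (Gamma0 N) (n + 2)) :=
      finiteDimensional_cuspForm_gamma0 N (n + 2)
    let E : Module.Dual ℂ (CuspForm (Gamma0 N) (n + 2)) →ₗ[ℝ] ℂ :=
      (LinearMap.applyₗ (R := ℂ) f).restrictScalars ℝ
    have hE : ∀ φ, E φ = φ f := fun φ ↦ rfl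
    have hφ : ∃ φ : Module.Dual ℂ (CuspForm (Gamma0 N) (n + 2)), φ f ≠ 0 := by
      by_contra h
      push Not at h
      exact hf0 ((Module.forall_dual_apply_eq_zero_iff ℂ f).mp h)
    obtain ⟨φ₀, hφ₀⟩ := hφ
    have hEsurj : Function.Surjective E := fun z ↦
      ⟨(z / φ₀ f) • φ₀, by rw [hE, LinearMap.smul_apply, smul_eq_mul, div_mul_cancel₀ z hφ₀]⟩
    have hCfE : Cf = E '' (cuspidalLatticeK (N := N) n : Set _) :=
      Set.image_congr fun φ _ ↦ (hE φ).symm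
    have hCf_span : Submodule.span ℝ Cf = ⊤ := by
      rw [hCfE, ← Submodule.map_span, cuspidalLatticeK_span_real_eq_top n hn, Submodule.map_top,
        LinearMap.range_eq_top.mpr hEsurj]
    rw [eq_top_iff, ← hCf_span, Submodule.span_le]
    intro z hz
    exact Submodule.subset_span (Submodule.subset_span hz : z ∈ R₀)
  obtain ⟨Ωp, Ωm, hp, hm, h⟩ := exists_re_im_of_conj_stable K hK R₀ hR₀2 hconj hspan
  exact ⟨Ωp, Ωm, hp, hm, h⟩

end Periods

/-! ### Critical values of a newform of weight `k ≥ 4` over its coefficient field -/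

section CriticalValues

open Complex

variable {N : ℕ} [NeZero N] {n : ℕ}

/-- `i^{j+1} Λ(j+1, f)` is real for `j` odd and purely imaginary for `j` even, when `f` has real
coefficients. [folklore] -/
theorem I_pow_mul_completedLValue_re_im (f : CuspForm (Gamma0 N) (n + 2)) (hf : HasRealCoefficients f)
    (j : ℕ) :
    (Odd j → (I ^ (j + 1) * completedLValue f (j + 1)).im = 0) ∧
    (Even j → (I ^ (j + 1) * completedLValue f (j + 1)).re = 0) := by
  have hΛ : (completedLValue f (j + 1)).im = 0 := completedLValue_im_eq_zero f hf (j + 1)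
  constructor
  · rintro ⟨m, rfl⟩
    have hI : I ^ (2 * m + 1 + 1) = (-1) ^ (m + 1) := by
      rw [show 2 * m + 1 + 1 = 2 * (m + 1) by ring, pow_mul, I_sq]
    rw [hI, mul_im, hΛ]
    have : ((-1 : ℂ) ^ (m + 1)).im = 0 := by
      rw [show (-1 : ℂ) = ((-1 : ℝ) : ℂ) by push_cast; rfl, ← ofReal_pow, ofReal_im]
    rw [this]
    ring
  · rintro ⟨m, rfl⟩
    have hI : I ^ (m + m + 1) = (-1) ^ m * I := by
      rw [pow_succ, ← two_mul, pow_mul, I_sq]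
    rw [hI, mul_re, mul_re, mul_im, Complex.I_re, Complex.I_im, hΛ]
    have : ((-1 : ℂ) ^ m).im = 0 := by
      rw [show (-1 : ℂ) = ((-1 : ℝ) : ℂ) by push_cast; rfl, ← ofReal_pow, ofReal_im]
    rw [this]
    ring

/-- **Rationality of the cuspidal periods and of the inner critical values of a newform of weight
`n + 2 ≥ 4` over its coefficient field** (Shimura 1977, Thm. 1; Manin 1973, Thm. 1.2–1.3 for level
one; Paşol–Popa 2013, Prop. 5.11(a),(c) and Cor. 5.12 for `1 < n' < k - 1`): there are real
`Ω⁺, Ω⁻ ≠ 0` with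
* every cuspidal period value `φ(f)`, `φ ∈ C`, of the form `a Ω⁺ + b Ω⁻ i`, `a, b ∈ K_f`;
* `i^{j+1} Λ(j+1, f) ∈ K_f Ω⁺` for odd `0 < j < n` and `i^{j+1} Λ(j+1, f) ∈ K_f Ω⁻ i` for even
  `0 < j < n` (`Λ(m, f) = completedLValue f m = ∫₀^∞ f(it) t^{m-1} dt`).
The two extreme critical values `Λ(1, f)`, `Λ(n+1, f)` (the Eisenstein direction of the period
polynomial) are not covered here. [cite: Shimura1977, Thm. 1] -/
theorem IsNewform0.exists_periods_criticalValues (hn : Even n) (hn0 : n ≠ 0)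
    {f : CuspForm (Gamma0 N) (n + 2)} (hf : IsNewform0 f) :
    ∃ Ωp Ωm : ℝ, Ωp ≠ 0 ∧ Ωm ≠ 0 ∧
      (∀ φ ∈ cuspidalLatticeK (N := N) n, ∃ a b : ℂ, a ∈ coeffField f ∧ b ∈ coeffField f ∧
        φ f = a * Ωp + b * Ωm * I) ∧
      (∀ j : ℕ, 0 < j → j < n → Odd j →
        I ^ (j + 1) * completedLValue f (j + 1) / Ωp ∈ coeffField f) ∧
      (∀ j : ℕ, 0 < j → j < n → Even j →
        I ^ (j + 1) * completedLValue f (j + 1) / (Ωm * I) ∈ coeffField f) := by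
  obtain ⟨Ωp, Ωm, hp, hm, h⟩ := hf.exists_re_im_mem_span_cuspidalLatticeK hn hn0
  have hreal : HasRealCoefficients f := hf.cuspCoeff_im_eq_zero
  have hp' : (Ωp : ℂ) ≠ 0 := by exact_mod_cast hp
  have hm' : (Ωm : ℂ) * I ≠ 0 := mul_ne_zero (by exact_mod_cast hm) I_ne_zero
  have hinner : ∀ j : ℕ, 0 < j → j < n →
      (∃ q : ℂ, q ∈ coeffField f ∧
        (((I ^ (j + 1) * completedLValue f (j + 1)).re : ℝ) : ℂ) = q * Ωp) ∧
      (∃ q : ℂ, q ∈ coeffField f ∧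
        (((I ^ (j + 1) * completedLValue f (j + 1)).im : ℝ) : ℂ) = q * Ωm) := by
    intro j hj0 hjn
    set jj : Fin (n + 1) := ⟨j, by omega⟩ with hjj
    have hj0' : jj ≠ 0 := fun h0 ↦ by
      have := congrArg Fin.val h0
      simp [hjj] at this
      omega
    have hjn' : jj ≠ Fin.last n := fun h0 ↦ by
      have := congrArg Fin.val h0
      simp [hjj] at this
      omega
    have hz := h _ (msymbMoment_one_apply_mem_span hn hn0 hj0' hjn' (coeffField f) f)
    rwa [msymbMoment_one_apply hn f jj] at hz
  refine ⟨Ωp, Ωm, hp, hm, fun φ hφ ↦ ?_, fun j hj0 hjn hjodd ↦ ?_, fun j hj0 hjn hjev ↦ ?_⟩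
  · obtain ⟨⟨a, ha, hae⟩, ⟨b, hb, hbe⟩⟩ := h _ (Submodule.subset_span ⟨φ, hφ, rfl⟩)
    refine ⟨a, b, ha, hb, ?_⟩
    rw [← hae, ← hbe]
    exact (Complex.re_add_im _).symm
  · obtain ⟨⟨a, ha, hae⟩, -⟩ := hinner j hj0 hjn
    have him := (I_pow_mul_completedLValue_re_im f hreal j).1 hjodd
    have hzeq : I ^ (j + 1) * completedLValue f (j + 1) = a * Ωp := by
      rw [← hae]
      exact Complex.ext (by simp) (by simp [him])
    rw [hzeq, mul_div_cancel_right₀ _ hp']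
    exact ha
  · obtain ⟨-, ⟨b, hb, hbe⟩⟩ := hinner j hj0 hjn
    have hre := (I_pow_mul_completedLValue_re_im f hreal j).2 hjev
    have hzeq : I ^ (j + 1) * completedLValue f (j + 1) = b * (Ωm * I) := by
      rw [← mul_assoc, ← hbe]
      exact Complex.ext (by simp [hre]) (by simp)
    rw [hzeq, mul_div_cancel_right₀ _ hm']
    exact hb

/-- **Paşol–Popa Cor. 5.12 and Prop. 5.11(c) for newforms on `Γ₀(N)` of even weight `k ≥ 4`,
except at the two extreme critical points `n' = 1, k - 1` and without Prop. 5.11(b)**: there are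
nonzero `ω⁺ ∈ i^{k+1}ℝ`, `ω⁻ ∈ i^kℝ` with `i^{n'} Λ(n', f)/ω⁻ ∈ K_f` for every even `0 < n' < k`
(the parity `(-1)^{n'} = -(-1)^{k-1}`; all these critical points are inner) and
`i^{n'} Λ(n', f)/ω⁺ ∈ K_f` for every odd `1 < n' < k - 1` (parity `(-1)^{n'} = (-1)^{k-1}`). The
missing cases of `PasolPopa2013_criticalValuesRationality` in even weight `k ≥ 4` are thus
`n' ∈ {1, k-1}` for `ω⁺` (Manin's coefficient theorem, via Hecke operators on `{0,∞}`) and part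
(b) (Haberland's formula, PP Thm. 3.3). [cite: PasolPopa2013, Prop. 5.11(c) and Cor. 5.12] -/
theorem IsNewform0.innerCriticalValues_mem_coeffField {k : ℤ} {f : CuspForm (Gamma0 N) k}
    (hf : IsNewform0 f) (hk : Even k) (hk4 : 4 ≤ k) :
    ∃ ωp ωm : ℂ, ωp ≠ 0 ∧ ωm ≠ 0 ∧
      (∀ n' : ℕ, 1 < n' → (n' : ℤ) < k - 1 → (n' : ℤ).negOnePow = (k - 1).negOnePow →
        I ^ n' * completedLValue f n' / ωp ∈ coeffField f) ∧
      (∀ n' : ℕ, 0 < n' → (n' : ℤ) < k → (n' : ℤ).negOnePow = -(k - 1).negOnePow →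
        I ^ n' * completedLValue f n' / ωm ∈ coeffField f) ∧
      (∃ r : ℝ, ωp = I ^ (k + 1) * r) ∧ (∃ r : ℝ, ωm = I ^ k * r) := by
  obtain ⟨t, ht⟩ : ∃ t : ℕ, k = 2 * (t : ℤ) + 2 := by
    obtain ⟨r, hr⟩ := hk
    refine ⟨(r - 1).toNat, ?_⟩
    rw [Int.toNat_of_nonneg (by omega)]
    omega
  subst ht
  have ht0 : t ≠ 0 := by rintro rfl; simp at hk4
  set n : ℕ := 2 * t with hn_def
  have hn : Even n := ⟨t, by omega⟩
  have hn0 : n ≠ 0 := by omega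
  have hcast : (2 * (t : ℤ) + 2 : ℤ) = (n : ℤ) + 2 := by rw [hn_def]; push_cast; ring
  -- transport `f` to weight `n + 2`
  revert f
  rw [hcast]
  intro f hf
  obtain ⟨Ωp, Ωm, hp, hm, -, hodd, heven⟩ := hf.exists_periods_criticalValues hn hn0
  have hk1 : ((n : ℤ) + 2 - 1).negOnePow = -1 :=
    Int.negOnePow_odd _ ⟨(n : ℤ) / 2 * 1 + t - t, by omega⟩
  refine ⟨Ωm * I, Ωp, mul_ne_zero (by exact_mod_cast hm) I_ne_zero, by exact_mod_cast hp,
    fun n' h1 h2 hpar ↦ ?_, fun n' h1 h2 hpar ↦ ?_, ?_, ?_⟩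
  · -- `+` parity: `n'` odd, inner
    rw [hk1, Int.negOnePow_eq_neg_one_iff] at hpar
    obtain ⟨m, hm'⟩ := hpar
    obtain ⟨j, rfl⟩ : ∃ j : ℕ, n' = j + 1 := ⟨n' - 1, by omega⟩
    have hjev : Even j := ⟨m.toNat, by omega⟩
    exact heven j (by omega) (by omega) hjev
  · -- `-` parity: `n'` even, automatically inner
    rw [hk1, neg_neg, Int.negOnePow_eq_one_iff] at hpar
    obtain ⟨m, hm'⟩ := hpar
    obtain ⟨j, rfl⟩ : ∃ j : ℕ, n' = j + 1 := ⟨n' - 1, by omega⟩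
    have hjodd : Odd j := ⟨(m - 1).toNat, by omega⟩
    exact hodd j (by omega) (by omega) hjodd
  · refine ⟨-((-1) ^ t * Ωm), ?_⟩
    rw [show (n : ℤ) + 2 + 1 = ((2 * (t + 1) + 1 : ℕ) : ℤ) by rw [hn_def]; push_cast; ring,
      zpow_natCast, pow_succ, pow_mul, I_sq]
    push_cast
    have hsq : ((-1 : ℂ) ^ t) * ((-1 : ℂ) ^ t) = 1 := by
      rw [← pow_add, ← two_mul, pow_mul, neg_one_sq, one_pow]
    linear_combination (-((Ωm : ℂ) * I)) * hsq
  · refine ⟨(-1) ^ (t + 1) * Ωp, ?_⟩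
    rw [show (n : ℤ) + 2 = ((2 * (t + 1) : ℕ) : ℤ) by rw [hn_def]; push_cast; ring, zpow_natCast,
      pow_mul, I_sq]
    push_cast
    have hsq : ((-1 : ℂ) ^ (t + 1)) * ((-1 : ℂ) ^ (t + 1)) = 1 := by
      rw [← pow_add, ← two_mul, pow_mul, neg_one_sq, one_pow]
    linear_combination (-(Ωp : ℂ)) * hsq

end CriticalValues

/-! ### Hecke operators on the symbol `{0, ∞}` in weight `k` (Manin's coefficient theorem) -/

section HeckeAtS

open Complex Matrix.SpecialLinearGroup ModularGroup Filter Asymptotics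

variable {N : ℕ} [NeZero N] {n : ℕ} {p : ℕ}

/-- Finite sums commute with the slash action: Mathlib's `SlashAction.sum_slash`, kept under its
old (private) name as a deprecated alias (dedup-00689); use the Mathlib lemma. [folklore] -/
@[deprecated SlashAction.sum_slash (since := "2026-08-15")]
private theorem finset_sum_slash_aux {ι : Type*} (s : Finset ι) (F : ι → ℍ → ℂ) (k : ℤ)
    (g : GL (Fin 2) ℝ) : (∑ i ∈ s, F i) ∣[k] g = ∑ i ∈ s, F i ∣[k] g :=
  SlashAction.sum_slash k g

omit [NeZero N] in
/-- **Factorisation of `βᵢ S` through `Γ₀(N) S` and an upper triangular matrix** (`p ∤ N`):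
for every Hecke representative `βᵢ ∈ Δ₀ᴺ(p)` there are `γ ∈ Γ₀(N)` and an integral upper
triangular `U` of determinant `p` with `γ S U = βᵢ S`; `U₁₁ = 1` for `β₀ = diag(1, p)` and `U₁₁ = p`
otherwise. For `βⱼ = (1 j; 0 p)`, `j ≢ 0`, `γ = (a j; -bN p)` with `ap + bjN = 1` moves the cusp
`j/p = βⱼS∞` to `0 = S∞` (cusps with denominator prime to `N` are `Γ₀(N)`-equivalent to `0`).
[folklore] -/
theorem exists_gamma0_S_upper_eq_heckeRep_mul_S (hp : p.Prime) (hpN : ¬p ∣ N) (i : Option (ZMod p)) :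
    ∃ (γ : SL(2, ℤ)) (U : Matrix (Fin 2) (Fin 2) ℤ), γ ∈ Gamma0 N ∧ U 1 0 = 0 ∧ U.det = p ∧
      U 1 1 = (if i = some 0 then 1 else (p : ℤ)) ∧
      (γ : Matrix (Fin 2) (Fin 2) ℤ) * ModularGroup.S * U = heckeRep p i * ModularGroup.S := by
  haveI : Fact p.Prime := ⟨hp⟩
  rcases i with _ | j
  · refine ⟨1, !![1, 0; 0, (p : ℤ)], one_mem _, by simp, by simp [Matrix.det_fin_two_of], by simp, ?_⟩
    ext a b
    fin_cases a <;> fin_cases b <;>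
      simp [Matrix.mul_apply, Fin.sum_univ_two, ModularGroup.coe_S, heckeRep]
  · by_cases hj : j = 0
    · subst hj
      refine ⟨1, !![(p : ℤ), 0; 0, 1], one_mem _, by simp, by simp [Matrix.det_fin_two_of], by simp, ?_⟩
      ext a b
      fin_cases a <;> fin_cases b <;>
        simp [Matrix.mul_apply, Fin.sum_univ_two, ModularGroup.coe_S, heckeRep]
    · -- Bezout: `a p + b (j N) = 1`
      have hpj : ¬p ∣ j.val := Nat.not_dvd_of_pos_of_lt (ZMod.val_pos.mpr hj) (ZMod.val_lt j)
      have hcop : Nat.Coprime p (j.val * N) :=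
        Nat.Coprime.mul_right ((Nat.Prime.coprime_iff_not_dvd hp).mpr hpj)
          ((Nat.Prime.coprime_iff_not_dvd hp).mpr hpN)
      have hcopZ : IsCoprime (p : ℤ) ((j.val : ℤ) * N) := by
        have := Nat.isCoprime_iff_coprime.mpr hcop
        push_cast at this
        exact this
      obtain ⟨a, b, hab⟩ := hcopZ
      let γ : SL(2, ℤ) := ⟨!![a, (j.val : ℤ); -(b * N), (p : ℤ)], by
        rw [Matrix.det_fin_two_of]; linear_combination hab⟩
      refine ⟨γ, !![1, -(b * N); 0, (p : ℤ)], ?_, by simp, by simp [Matrix.det_fin_two_of], ?_, ?_⟩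
      · rw [Gamma0_mem]
        change (((!![a, (j.val : ℤ); -(b * N), (p : ℤ)] : Matrix (Fin 2) (Fin 2) ℤ) 1 0 : ℤ) : ZMod N) = 0
        simp
      · simp [hj]
      · change (!![a, (j.val : ℤ); -(b * N), (p : ℤ)] : Matrix (Fin 2) (Fin 2) ℤ) * ModularGroup.S *
          !![1, -(b * N); 0, (p : ℤ)] = heckeRep p (some j) * ModularGroup.S
        simp only [ZMod.natCast_val] at hab
        ext x y
        fin_cases x <;> fin_cases y <;>
          simp [Matrix.mul_apply, Fin.sum_univ_two, ModularGroup.coe_S, heckeRep, ZMod.natCast_val] <;>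
          first | ring1 | linear_combination (-1 : ℤ) * hab

/-- **The kernel of `f ∣ (δU)`, `δ ∈ SL(2, ℤ)`, `U` integral upper triangular**:
`∫_τ^{i∞} (f∣δU)(z)(zv-u)ⁿ dz = c_f(δ)(Uq) + ∫_{δUτ}^{i∞} f(z) (z(δUq)₁ - (δUq)₀)ⁿ dz`
(`f ∣ δU = (f∣δ) ∣ U`, the kernel of a translate by the parabolic `U` is the translated kernel,
`eichlerKernel_slash_eq_of_apply_one_zero`, and `periodFn_eq` at the base point `Uτ`). [folklore] -/
theorem eichlerKernel_slash_sl_mul_upper (f : CuspForm (Gamma0 N) (n + 2)) (δ : SL(2, ℤ))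
    {U : Matrix (Fin 2) (Fin 2) ℤ} (hU10 : U 1 0 = 0) (hU : 0 < U.det) (τ : ℍ) (q : Fin 2 → ℂ) :
    eichlerKernel n (⇑f ∣[(n + 2 : ℤ)] intGL ((δ : Matrix (Fin 2) (Fin 2) ℤ) * U)) τ q =
      periodFn n f δ ((zcmat U).mulVec q) +
        eichlerKernel n ⇑f (intGL ((δ : Matrix (Fin 2) (Fin 2) ℤ) * U) • τ)
          ((zcmat ((δ : Matrix (Fin 2) (Fin 2) ℤ) * U)).mulVec q) := by
  have hδdet : (δ : Matrix (Fin 2) (Fin 2) ℤ).det ≠ 0 := by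
    rw [Matrix.SpecialLinearGroup.det_coe]; exact one_ne_zero
  have hUdet : U.det ≠ 0 := hU.ne'
  have hA : 0 < ((δ : Matrix (Fin 2) (Fin 2) ℤ) * U).det := by
    rw [Matrix.det_mul, Matrix.SpecialLinearGroup.det_coe, one_mul]; exact hU
  have hsplit : intGL ((δ : Matrix (Fin 2) (Fin 2) ℤ) * U) = (δ : GL (Fin 2) ℝ) * intGL U := by
    rw [intGL_mul hδdet hUdet]
    congr 1
    exact (mapGL_eq_intGL δ).symm
  have hf1 : ⇑f ∣[(n + 2 : ℤ)] intGL ((δ : Matrix (Fin 2) (Fin 2) ℤ) * U) =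
      (⇑f ∣[(n + 2 : ℤ)] δ) ∣[(n + 2 : ℤ)] intGL U := by
    rw [hsplit, SlashAction.slash_mul, ModularForm.SL_slash]
  have hφ := isCuspFunction_slash f δ
  have hψ : IsCuspFunction ((N : ℝ) * ((δ : Matrix (Fin 2) (Fin 2) ℤ) * U).det)
      ((⇑f ∣[(n + 2 : ℤ)] δ) ∣[(n + 2 : ℤ)] intGL U) := hf1 ▸ isCuspFunction_slash_intGL f hA
  have hg : 0 < (intGL U).det.val := det_intGL_pos hU
  have hg10 : (intGL U) 1 0 = 0 := by rw [intGL_apply hUdet]; exact_mod_cast hU10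
  have key := hφ.eichlerKernel_slash_eq_of_apply_one_zero hg hg10 hψ q τ
  rw [hf1, key, cmat_intGL hUdet, periodFn_eq f δ ((zcmat U).mulVec q) (intGL U • τ),
    ModularGroup.sl_moeb, ← mul_smul, ← hsplit, icmat_eq_zcmat, Matrix.mulVec_mulVec, ← zcmat_mul]
  ring

/-- **Hecke operators on the period at `S`.** If `βᵢ S = δᵢ Uᵢ` with `δᵢ ∈ SL(2, ℤ)` and `Uᵢ`
integral upper triangular (`i ∈ I_p(N)`), then
`c_{T_p f}(S)(q) = ∑ᵢ c_f(δᵢ)(Uᵢ q)`: both kernel terms of `c_{T_p f}(S)` unfold over the coset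
representatives (`coe_heckeT_gamma0`), and the terms `∫_{βᵢSτ}^{i∞} f …` cancel
(`eichlerKernel_slash_sl_mul_upper`, `eichlerKernel_slash_eq_of_apply_one_zero`). For level one and
`δᵢ` the Manin–Heilbronn matrices this is Manin's action of `T_p` on period polynomials
(Manin 1973, §1; Paşol–Popa 2013, (4.1)–(4.2) with Prop. 4.1). [cite: PasolPopa2013, §4 (4.1)–(4.2) and Prop. 4.1] -/
theorem periodFn_heckeT_S [NeZero p] (hp : p.Prime) (f : CuspForm (Gamma0 N) (n + 2)) (q : Fin 2 → ℂ)
    (δ : HeckeIdx N p → SL(2, ℤ)) (U : HeckeIdx N p → Matrix (Fin 2) (Fin 2) ℤ)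
    (hU10 : ∀ i, U i 1 0 = 0) (hUdet : ∀ i, 0 < (U i).det)
    (hfac : ∀ i, ((δ i : SL(2, ℤ)) : Matrix (Fin 2) (Fin 2) ℤ) * U i = heckeRep p i.1 * ModularGroup.S) :
    periodFn n (heckeT (Gamma0 N) (n + 2) p f) ModularGroup.S q =
      ∑ i : HeckeIdx N p, periodFn n f (δ i) ((zcmat (U i)).mulVec q) := by
  haveI : Fact p.Prime := ⟨hp⟩
  have hp0 := det_heckeRep_ne_zero (NeZero.ne p)
  have hSdet : ((ModularGroup.S : SL(2, ℤ)) : Matrix (Fin 2) (Fin 2) ℤ).det ≠ 0 := by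
    rw [Matrix.SpecialLinearGroup.det_coe]; exact one_ne_zero
  have hT := coe_heckeT_gamma0 (N := N) (k := (n + 2 : ℤ)) p hp f
  have hScoe : ((ModularGroup.S : SL(2, ℤ)) : GL (Fin 2) ℝ) = intGL (ModularGroup.S : SL(2, ℤ)) :=
    mapGL_eq_intGL _
  -- `βᵢ S = δᵢ Uᵢ` in `GL(2, ℝ)` and on vectors
  have hGL : ∀ i : HeckeIdx N p, intGL (heckeRep p i.1) * ((ModularGroup.S : SL(2, ℤ)) : GL (Fin 2) ℝ) =
      intGL (((δ i : SL(2, ℤ)) : Matrix (Fin 2) (Fin 2) ℤ) * U i) := fun i ↦ by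
    rw [hScoe, ← intGL_mul (hp0 _) hSdet, ← hfac i]
  have hvec : ∀ i : HeckeIdx N p, (zcmat (heckeRep p i.1)).mulVec ((icmat ModularGroup.S).mulVec q) =
      (zcmat (((δ i : SL(2, ℤ)) : Matrix (Fin 2) (Fin 2) ℤ) * U i)).mulVec q := fun i ↦ by
    rw [icmat_eq_zcmat, Matrix.mulVec_mulVec, ← zcmat_mul, ← hfac i]
  -- first kernel term
  have h1 : eichlerKernel n (⇑(heckeT (Gamma0 N) (n + 2) p f) ∣[(n + 2 : ℤ)] ModularGroup.S)
      UpperHalfPlane.I q =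
      ∑ i : HeckeIdx N p, (periodFn n f (δ i) ((zcmat (U i)).mulVec q) +
        eichlerKernel n ⇑f (intGL (((δ i : SL(2, ℤ)) : Matrix (Fin 2) (Fin 2) ℤ) * U i) • UpperHalfPlane.I)
          ((zcmat (((δ i : SL(2, ℤ)) : Matrix (Fin 2) (Fin 2) ℤ) * U i)).mulVec q)) := by
    have hsum : ⇑(heckeT (Gamma0 N) (n + 2) p f) ∣[(n + 2 : ℤ)] ModularGroup.S =
        ∑ i : HeckeIdx N p, ⇑f ∣[(n + 2 : ℤ)] intGL (((δ i : SL(2, ℤ)) : Matrix (Fin 2) (Fin 2) ℤ) * U i) := by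
      rw [hT, ModularForm.SL_slash, SlashAction.sum_slash]
      refine Finset.sum_congr rfl fun i _ ↦ ?_
      rw [← SlashAction.slash_mul, hGL i]
    have hA : ∀ i : HeckeIdx N p, 0 < ((((δ i : SL(2, ℤ)) : Matrix (Fin 2) (Fin 2) ℤ) * U i)).det :=
      fun i ↦ by rw [Matrix.det_mul, Matrix.SpecialLinearGroup.det_coe, one_mul]; exact hUdet i
    rw [hsum, eichlerKernel_finset_sum Finset.univ (fun i _ ↦ isCuspFunction_slash_intGL f (hA i))]
    exact Finset.sum_congr rfl fun i _ ↦ eichlerKernel_slash_sl_mul_upper f (δ i) (hU10 i) (hUdet i) _ _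
  -- second kernel term
  have h2 : eichlerKernel n ⇑(heckeT (Gamma0 N) (n + 2) p f) (ModularGroup.S • UpperHalfPlane.I)
      ((icmat ModularGroup.S).mulVec q) =
      ∑ i : HeckeIdx N p,
        eichlerKernel n ⇑f (intGL (((δ i : SL(2, ℤ)) : Matrix (Fin 2) (Fin 2) ℤ) * U i) • UpperHalfPlane.I)
          ((zcmat (((δ i : SL(2, ℤ)) : Matrix (Fin 2) (Fin 2) ℤ) * U i)).mulVec q) := by
    rw [hT, eichlerKernel_finset_sum Finset.univ (fun i _ ↦ isCuspFunction_slash_heckeRep f i.1)]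
    refine Finset.sum_congr rfl fun i _ ↦ ?_
    rw [(isCuspFunction_one f).eichlerKernel_slash_eq_of_apply_one_zero (det_intGL_heckeRep_pos _)
      (intGL_heckeRep_apply_one_zero _) (isCuspFunction_slash_heckeRep f i.1), cmat_intGL (hp0 _),
      ModularGroup.sl_moeb, ← mul_smul, hGL i, hvec i]
  rw [periodFn, h1, h2, Finset.sum_add_distrib, add_sub_cancel_right]

/-- **Manin's coefficient theorem at the level of functionals.** For a prime `p ∤ N`, even `n` and
`q ∈ ℤ²`, `T_p^∨ λ_{S,q} - (1 + p^{n+1}) λ_{S,q}` is the image of a boundary-free rational M-symbol: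
with `βᵢ S = γᵢ S Uᵢ` (`exists_gamma0_S_upper_eq_heckeRep_mul_S`),
`T_p^∨ λ_{S,q} = ∑ᵢ λ_{γᵢS, Uᵢq}` (`periodFn_heckeT_S`), every `γᵢ S ∞` is the cusp `0 = S∞`, and
the boundaries `∑ᵢ ((Uᵢq)₁ⁿ [0] - ((βᵢSq)₁)ⁿ [∞]) = (1 + p^{n+1})(q₁ⁿ [0] - q₀ⁿ [∞])` match:
`T_p` acts on the boundary at the cusps `0` and `∞` by the Eisenstein eigenvalue `1 + p^{k-1}`
(Manin 1973, Thm. 1.3 / Paşol–Popa 2013, proof of Prop. 5.11(a) with Cor. 8.9). [cite: PasolPopa2013, proof of Prop. 5.11(a)] -/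
theorem dualMap_heckeT_periodFnDual_S_sub_mem [NeZero p] (hn : Even n) (hp : p.Prime) (hpN : ¬p ∣ N)
    (q : Fin 2 → ℤ) :
    (heckeT (Gamma0 N) (n + 2) p).dualMap (periodFnDual n ModularGroup.S q) -
        ((1 : ℚ) + (p : ℚ) ^ (n + 1)) • periodFnDual n ModularGroup.S q ∈
      (LinearMap.ker (bdryKMap N n)).map (msymbKMap N n) := by
  classical
  haveI : Fact p.Prime := ⟨hp⟩
  choose γ U hγ hU10 hUdet hU11 hfac using
    fun i : HeckeIdx N p ↦ exists_gamma0_S_upper_eq_heckeRep_mul_S (N := N) hp hpN i.1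
  have hUpos : ∀ i, 0 < (U i).det := fun i ↦ by rw [hUdet i]; exact_mod_cast hp.pos
  have hfac' : ∀ i, ((γ i * ModularGroup.S : SL(2, ℤ)) : Matrix (Fin 2) (Fin 2) ℤ) * U i =
      heckeRep p i.1 * ModularGroup.S := fun i ↦ by
    rw [Matrix.SpecialLinearGroup.coe_mul]; exact hfac i
  -- `T_p^∨ λ_{S,q} = ∑ᵢ λ_{γᵢ S, Uᵢ q}`
  have hTq : (heckeT (Gamma0 N) (n + 2) p).dualMap (periodFnDual n ModularGroup.S q) =
      ∑ i : HeckeIdx N p, periodFnDual n (γ i * ModularGroup.S) ((U i).mulVec q) := by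
    ext f
    rw [LinearMap.dualMap_apply, periodFnDual_apply, LinearMap.coe_sum, Finset.sum_apply,
      periodFn_heckeT_S hp f _ (fun i ↦ γ i * ModularGroup.S) U hU10 hUpos hfac']
    refine Finset.sum_congr rfl fun i _ ↦ ?_
    rw [periodFnDual_apply, zcmat_mulVec_intCast]
  -- chains
  choose c _ hcΨ hcδ using fun i : HeckeIdx N p ↦
    exists_chainK (N := N) n hn (γ i * ModularGroup.S) ((U i).mulVec q)
  obtain ⟨c₀, -, hc₀Ψ, hc₀δ⟩ := exists_chainK (N := N) n hn ModularGroup.S q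
  have horb : ∀ i, cuspOrbitOf N (γ i * ModularGroup.S) = cuspOrbitOf N ModularGroup.S :=
    fun i ↦ cuspOrbitOf_mul_of_mem (hγ i) _
  -- the two boundary sums
  have hS1 : ∑ i : HeckeIdx N p, ((((U i).mulVec q) 1 : ℤ) : ℚ) ^ n =
      ((1 : ℚ) + (p : ℚ) ^ (n + 1)) * ((q 1 : ℤ) : ℚ) ^ n := by
    set g : Option (ZMod p) → ℚ :=
      fun o ↦ ((if o = some 0 then (1 : ℚ) else (p : ℚ)) * ((q 1 : ℤ) : ℚ)) ^ n with hg
    have hterm : ∀ i : HeckeIdx N p, ((((U i).mulVec q) 1 : ℤ) : ℚ) ^ n = g i.1 := by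
      intro i
      have : (U i).mulVec q 1 = U i 1 1 * q 1 := by
        simp [Matrix.mulVec, dotProduct, Fin.sum_univ_two, hU10 i]
      rw [this, hU11 i, hg]
      push_cast
      split_ifs <;> simp
    rw [Finset.sum_congr rfl fun i _ ↦ hterm i, sum_heckeIdx N p g, if_neg hpN]
    have h0 : g (some 0) = ((q 1 : ℤ) : ℚ) ^ n := by simp [hg]
    have hne : ∀ j : ZMod p, j ≠ 0 → g (some j) = ((p : ℚ) * ((q 1 : ℤ) : ℚ)) ^ n := fun j hj ↦ by
      simp [hg, hj]
    have hnone : g none = ((p : ℚ) * ((q 1 : ℤ) : ℚ)) ^ n := by simp [hg]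
    rw [← Finset.add_sum_erase _ _ (Finset.mem_univ (0 : ZMod p)), h0,
      Finset.sum_congr rfl fun j hj ↦ hne j (Finset.ne_of_mem_erase hj), Finset.sum_const,
      Finset.card_erase_of_mem (Finset.mem_univ _), Finset.card_univ, ZMod.card, hnone, nsmul_eq_mul,
      Nat.cast_sub hp.one_le]
    push_cast
    ring
  have hS2 : ∑ i : HeckeIdx N p,
      (((((γ i * ModularGroup.S : SL(2, ℤ)) : Matrix (Fin 2) (Fin 2) ℤ).mulVec ((U i).mulVec q)) 1 : ℤ) : ℚ) ^ n =
      ((1 : ℚ) + (p : ℚ) ^ (n + 1)) *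
        (((((ModularGroup.S : SL(2, ℤ)) : Matrix (Fin 2) (Fin 2) ℤ).mulVec q) 1 : ℤ) : ℚ) ^ n := by
    set g : Option (ZMod p) → ℚ :=
      fun o ↦ ((((heckeRep p o * ModularGroup.S).mulVec q) 1 : ℤ) : ℚ) ^ n with hg
    have hterm : ∀ i : HeckeIdx N p,
        (((((γ i * ModularGroup.S : SL(2, ℤ)) : Matrix (Fin 2) (Fin 2) ℤ).mulVec ((U i).mulVec q)) 1 : ℤ) : ℚ) ^ n =
        g i.1 := by
      intro i
      rw [hg, Matrix.mulVec_mulVec, hfac' i]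
    rw [Finset.sum_congr rfl fun i _ ↦ hterm i, sum_heckeIdx N p g, if_neg hpN]
    have hsome : ∀ j : ZMod p, g (some j) = ((p : ℚ) * ((q 0 : ℤ) : ℚ)) ^ n := fun j ↦ by
      have : ((heckeRep p (some j) * ModularGroup.S).mulVec q) 1 = p * q 0 := by
        simp [heckeRep, ModularGroup.coe_S, Matrix.mulVec, dotProduct, Fin.sum_univ_two, Matrix.mul_apply]
      rw [hg]
      simp only [this]
      push_cast
      ring
    have hnone : g none = (((q 0 : ℤ) : ℚ)) ^ n := by
      have : ((heckeRep p none * ModularGroup.S).mulVec q) 1 = q 0 := by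
        simp [heckeRep, ModularGroup.coe_S, Matrix.mulVec, dotProduct, Fin.sum_univ_two, Matrix.mul_apply]
      rw [hg]
      simp only [this]
    have hS : (((ModularGroup.S : SL(2, ℤ)) : Matrix (Fin 2) (Fin 2) ℤ).mulVec q) 1 = q 0 := by
      simp [ModularGroup.coe_S, Matrix.mulVec, dotProduct, Fin.sum_univ_two]
    simp_rw [hsome]
    rw [hnone, hS, Finset.sum_const, Finset.card_univ, ZMod.card, nsmul_eq_mul]
    ring
  refine ⟨∑ i, c i - ((1 : ℚ) + (p : ℚ) ^ (n + 1)) • c₀, ?_, ?_⟩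
  · rw [SetLike.mem_coe, LinearMap.mem_ker, map_sub, map_smul, map_sum]
    simp_rw [hcδ, horb]
    rw [hc₀δ, Finset.sum_sub_distrib, ← Finset.sum_smul, ← Finset.sum_smul, hS1, hS2, smul_sub,
      smul_smul, smul_smul]
    abel
  · rw [map_sub, map_smul, map_sum]
    simp_rw [hcΨ]
    rw [hc₀Ψ, hTq]

/-- **The Hecke eigenvalue of a cusp form is never the Eisenstein eigenvalue, for large `p`**
(`n ≥ 2`): by Hecke's bound `a_m(f) = O(m^{k/2})` (Mathlib `CuspFormClass.qExpansion_isBigO`)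
there is a prime `p ∤ N` with `a_p(f) ≠ 1 + p^{n+1}` (indeed `1 + p^{n+1} > C p^{n/2+1}` for
`p > C`). This is the "nontrivial upper bound" input of Paşol–Popa's proof of Prop. 5.11(a)
("the eigenvalues of an Eisenstein series … are of order `n^{k-1}`"). [cite: PasolPopa2013, proof of Prop. 5.11(a)] -/
theorem exists_prime_cuspCoeff_ne_eisenstein (hn : 2 ≤ n) (f : CuspForm (Gamma0 N) (n + 2)) :
    ∃ p : ℕ, p.Prime ∧ ¬p ∣ N ∧ cuspCoeff f p ≠ 1 + (p : ℂ) ^ (n + 1) := by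
  have hO := CuspFormClass.qExpansion_isBigO (Γ := ((Gamma0 N : Subgroup SL(2, ℤ)) : Subgroup (GL (Fin 2) ℝ)))
    (k := (n + 2 : ℤ)) f
  rw [CongruenceSubgroup.strictWidthInfty_Gamma0] at hO
  obtain ⟨C, hC0, hC⟩ := hO.exists_pos
  rw [IsBigOWith, Filter.eventually_atTop] at hC
  obtain ⟨m₀, hm₀⟩ := hC
  obtain ⟨p, hp_ge, hp⟩ := Nat.exists_infinite_primes (max (max m₀ (N + 1)) (Nat.ceil C + 1))
  have hpm₀ : m₀ ≤ p := le_trans (le_trans (le_max_left _ _) (le_max_left _ _)) hp_ge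
  have hpN' : N < p := lt_of_lt_of_le (lt_of_lt_of_le (Nat.lt_succ_self N)
    (le_trans (le_max_right _ _) (le_max_left _ _))) hp_ge
  have hpC : C < p := by
    have : (Nat.ceil C + 1 : ℕ) ≤ p := le_trans (le_max_right _ _) hp_ge
    have h1 : C ≤ Nat.ceil C := Nat.le_ceil C
    have h2 : ((Nat.ceil C + 1 : ℕ) : ℝ) ≤ p := by exact_mod_cast this
    push_cast at h2
    linarith
  refine ⟨p, hp, Nat.not_dvd_of_pos_of_lt (Nat.pos_of_ne_zero (NeZero.ne N)) hpN', fun heq ↦ ?_⟩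
  have hbound : ‖(qExpansion 1 ⇑f).coeff p‖ ≤ C * ‖(p : ℝ) ^ ((((n : ℤ) + 2 : ℤ) : ℝ) / 2)‖ :=
    hm₀ p hpm₀
  rw [cuspCoeff] at heq
  rw [heq] at hbound
  have hp1 : (1 : ℝ) ≤ p := by exact_mod_cast hp.one_le
  have hp0 : (0 : ℝ) < p := by positivity
  have hlhs : ‖(1 : ℂ) + (p : ℂ) ^ (n + 1)‖ = 1 + (p : ℝ) ^ (n + 1) := by
    rw [show (1 : ℂ) + (p : ℂ) ^ (n + 1) = (((1 + (p : ℝ) ^ (n + 1) : ℝ)) : ℂ) by push_cast; ring,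
      Complex.norm_real, Real.norm_of_nonneg (by positivity)]
  have hrpow : (p : ℝ) ^ ((((n : ℤ) + 2 : ℤ) : ℝ) / 2) ≤ (p : ℝ) ^ n := by
    have hn' : (2 : ℝ) ≤ n := by exact_mod_cast hn
    have hle : (((n : ℤ) + 2 : ℤ) : ℝ) / 2 ≤ (n : ℝ) := by push_cast; linarith
    calc (p : ℝ) ^ ((((n : ℤ) + 2 : ℤ) : ℝ) / 2) ≤ (p : ℝ) ^ (n : ℝ) :=
          Real.rpow_le_rpow_of_exponent_le hp1 hle
      _ = (p : ℝ) ^ n := Real.rpow_natCast _ _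
  have hnorm : ‖(p : ℝ) ^ ((((n : ℤ) + 2 : ℤ) : ℝ) / 2)‖ = (p : ℝ) ^ ((((n : ℤ) + 2 : ℤ) : ℝ) / 2) :=
    Real.norm_of_nonneg (Real.rpow_nonneg hp0.le _)
  rw [hlhs, hnorm] at hbound
  have h1 : (1 : ℝ) + (p : ℝ) ^ (n + 1) ≤ C * (p : ℝ) ^ n :=
    hbound.trans (mul_le_mul_of_nonneg_left hrpow hC0.le)
  have h2 : C * (p : ℝ) ^ n < (p : ℝ) ^ (n + 1) := by
    rw [pow_succ']
    exact mul_lt_mul_of_pos_right hpC (by positivity)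
  linarith

end HeckeAtS


/-! ### The extreme critical values and the full Cor. 5.12 / Prop. 5.11(c) in even weight `k ≥ 4` -/

section Extremes

open Complex Module Submodule

variable {N : ℕ} [NeZero N] {n : ℕ}

/-- Values at `f` of rational cuspidal classes lie in the `K`-span of the cuspidal period values
of `f`. [folklore] -/
theorem apply_mem_span_of_mem_span_cuspidalLatticeK {ψ : Module.Dual ℂ (CuspForm (Gamma0 N) (n + 2))}
    (hψ : ψ ∈ Submodule.span ℚ (cuspidalLatticeK (N := N) n :
      Set (Module.Dual ℂ (CuspForm (Gamma0 N) (n + 2)))))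
    (K : IntermediateField ℚ ℂ) (f : CuspForm (Gamma0 N) (n + 2)) :
    ψ f ∈ Submodule.span K
      ((fun φ : Module.Dual ℂ (CuspForm (Gamma0 N) (n + 2)) ↦ φ f) '' (cuspidalLatticeK (N := N) n)) := by
  let E : Module.Dual ℂ (CuspForm (Gamma0 N) (n + 2)) →ₗ[ℚ] ℂ :=
    (LinearMap.applyₗ (R := ℂ) f).restrictScalars ℚ
  have hE : ∀ φ, E φ = φ f := fun φ ↦ rfl
  have h1 : E ψ ∈ (Submodule.span ℚ (cuspidalLatticeK (N := N) n :
      Set (Module.Dual ℂ (CuspForm (Gamma0 N) (n + 2))))).map E := Submodule.mem_map_of_mem hψ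
  rw [Submodule.map_span] at h1
  rw [← hE]
  refine Submodule.span_le.mpr ?_ (Submodule.span_subset_span ℚ K _ h1)
  rintro _ ⟨φ, hφ, rfl⟩
  exact Submodule.subset_span ⟨φ, hφ, rfl⟩

/-- **The period of a newform at `S` lies in its `K_f`-structure** (even weight `n + 2 ≥ 4`):
choose a prime `p ∤ N` with `a_p ≠ 1 + p^{n+1}` (`exists_prime_cuspCoeff_ne_eisenstein`); then
`(a_p - 1 - p^{n+1}) c_f(S)(q) = (T_p^∨ λ_{S,q} - (1+p^{n+1})λ_{S,q})(f)` is the value of a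
rational cuspidal class (`dualMap_heckeT_periodFnDual_S_sub_mem`, `ℚC = Ψ(ker δ)`), and
`a_p - 1 - p^{n+1} ∈ K_f^×` (Manin 1973, Thm. 1.3; Paşol–Popa 2013, proof of Prop. 5.11(a)). [cite: PasolPopa2013, proof of Prop. 5.11(a)] -/
theorem IsNewform0.periodFn_S_mem_span (hn : Even n) (hn0 : n ≠ 0) {f : CuspForm (Gamma0 N) (n + 2)}
    (hf : IsNewform0 f) (q : Fin 2 → ℤ) :
    periodFn n f ModularGroup.S (fun i ↦ (q i : ℂ)) ∈ Submodule.span (coeffField f)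
      ((fun φ : Module.Dual ℂ (CuspForm (Gamma0 N) (n + 2)) ↦ φ f) '' (cuspidalLatticeK (N := N) n)) := by
  have hn2 : 2 ≤ n := by obtain ⟨m, rfl⟩ := hn; omega
  obtain ⟨p, hp, hpN, hne⟩ := exists_prime_cuspCoeff_ne_eisenstein (N := N) hn2 f
  haveI : NeZero p := ⟨hp.ne_zero⟩
  set K := coeffField f with hKdef
  set R₀ := Submodule.span K
    ((fun φ : Module.Dual ℂ (CuspForm (Gamma0 N) (n + 2)) ↦ φ f) '' (cuspidalLatticeK (N := N) n))
  have hmem := dualMap_heckeT_periodFnDual_S_sub_mem (N := N) hn hp hpN q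
  rw [← span_cuspidalLatticeK_eq_map_ker hn hn0] at hmem
  have hv := apply_mem_span_of_mem_span_cuspidalLatticeK hmem K f
  -- the value is `(a_p - 1 - p^{n+1}) c_f(S)(q)`
  set c : ℂ := periodFn n f ModularGroup.S (fun i ↦ (q i : ℂ)) with hc
  set d : ℂ := cuspCoeff f p - (1 + (p : ℂ) ^ (n + 1)) with hd
  have hval : (((heckeT (Gamma0 N) (n + 2) p).dualMap (periodFnDual n ModularGroup.S q) -
      ((1 : ℚ) + (p : ℚ) ^ (n + 1)) • periodFnDual n ModularGroup.S q :
        Module.Dual ℂ (CuspForm (Gamma0 N) (n + 2))) f) = d * c := by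
    rw [LinearMap.sub_apply, LinearMap.smul_apply, LinearMap.dualMap_apply,
      hf.heckeT_eq_coeff_smul hp, map_smul, periodFnDual_apply, smul_eq_mul, Rat.smul_def, hd, hc]
    push_cast
    simp only [cuspCoeff]
    ring
  rw [hval] at hv
  have hdK : d ∈ K := sub_mem (coeff_mem_coeffField f p)
    (add_mem (one_mem _) (pow_mem (natCast_mem K p) _))
  have hd0 : d ≠ 0 := sub_ne_zero.mpr hne
  have : c = (⟨d⁻¹, inv_mem hdK⟩ : K) • (d * c) := by
    rw [IntermediateField.smul_def, smul_eq_mul, ← mul_assoc, inv_mul_cancel₀ hd0, one_mul]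
  rw [this]
  exact Submodule.smul_mem _ _ hv

/-- **The two extreme critical values lie in the `K_f`-structure**: `iΛ(1, f) = -c_f(S)(0, 1)` and
`i^{n+1}Λ(n+1, f) = -c_f(S)(1, 0)` (`periodFn_S`). [cite: PasolPopa2013, Cor. 5.12] -/
theorem IsNewform0.extreme_criticalValues_mem_span (hn : Even n) (hn0 : n ≠ 0)
    {f : CuspForm (Gamma0 N) (n + 2)} (hf : IsNewform0 f) :
    I ^ (0 + 1) * completedLValue f (0 + 1) ∈ Submodule.span (coeffField f)
        ((fun φ : Module.Dual ℂ (CuspForm (Gamma0 N) (n + 2)) ↦ φ f) '' (cuspidalLatticeK (N := N) n)) ∧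
      I ^ (n + 1) * completedLValue f (n + 1) ∈ Submodule.span (coeffField f)
        ((fun φ : Module.Dual ℂ (CuspForm (Gamma0 N) (n + 2)) ↦ φ f) '' (cuspidalLatticeK (N := N) n)) := by
  constructor
  · have h := hf.periodFn_S_mem_span hn hn0 ![0, 1]
    rw [periodFn_S, Finset.sum_eq_single 0 (fun j hj hj0 ↦ by
        simp [zero_pow hj0]) (by simp)] at h
    simp only [Matrix.cons_val_zero, Matrix.cons_val_one, Int.cast_zero, Int.cast_one,
      pow_zero, one_pow, mul_one, Nat.choose_zero_right, Nat.cast_one, one_mul, Nat.sub_zero] at h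
    simpa using neg_mem h
  · have h := hf.periodFn_S_mem_span hn hn0 ![1, 0]
    rw [periodFn_S, Finset.sum_eq_single n (fun j hj hjn ↦ by
        have : n - j ≠ 0 := by
          have := Finset.mem_range.mp hj
          omega
        simp [zero_pow this]) (by simp)] at h
    simp only [Matrix.cons_val_zero, Matrix.cons_val_one, Int.cast_zero, Int.cast_one,
      one_pow, mul_one, Nat.choose_self, Nat.cast_one, one_mul, Nat.sub_self, pow_zero] at h
    simpa using neg_mem h

/-- **Rationality of the periods and of all critical values of a newform of even weight
`n + 2 ≥ 4` over its coefficient field** (Shimura 1977, Thm. 1; Manin 1973, Thm. 1.2–1.3;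
Paşol–Popa 2013, Prop. 5.11(a),(c) and Cor. 5.12): there are real `Ω⁺, Ω⁻ ≠ 0` with every
cuspidal period value of the form `a Ω⁺ + b Ω⁻ i` (`a, b ∈ K_f`), `i^{j+1}Λ(j+1, f) ∈ K_f Ω⁺` for
odd `0 < j < n` and `i^{j+1}Λ(j+1, f) ∈ K_f Ω⁻ i` for all even `0 ≤ j ≤ n`. [cite: PasolPopa2013, Prop. 5.11 (a),(c) and Cor. 5.12] -/
theorem IsNewform0.exists_periods_criticalValues' (hn : Even n) (hn0 : n ≠ 0)
    {f : CuspForm (Gamma0 N) (n + 2)} (hf : IsNewform0 f) :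
    ∃ Ωp Ωm : ℝ, Ωp ≠ 0 ∧ Ωm ≠ 0 ∧
      (∀ φ ∈ cuspidalLatticeK (N := N) n, ∃ a b : ℂ, a ∈ coeffField f ∧ b ∈ coeffField f ∧
        φ f = a * Ωp + b * Ωm * I) ∧
      (∀ j : ℕ, 0 < j → j < n → Odd j →
        I ^ (j + 1) * completedLValue f (j + 1) / Ωp ∈ coeffField f) ∧
      (∀ j : ℕ, j ≤ n → Even j →
        I ^ (j + 1) * completedLValue f (j + 1) / (Ωm * I) ∈ coeffField f) := by
  obtain ⟨Ωp, Ωm, hp, hm, h⟩ := hf.exists_re_im_mem_span_cuspidalLatticeK hn hn0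
  have hreal : HasRealCoefficients f := hf.cuspCoeff_im_eq_zero
  have hp' : (Ωp : ℂ) ≠ 0 := by exact_mod_cast hp
  have hm' : (Ωm : ℂ) * I ≠ 0 := mul_ne_zero (by exact_mod_cast hm) I_ne_zero
  -- every `i^{j+1}Λ(j+1,f)`, `j ≤ n`, is in the `K_f`-plane
  have hall : ∀ j : ℕ, j ≤ n →
      (∃ q : ℂ, q ∈ coeffField f ∧
        (((I ^ (j + 1) * completedLValue f (j + 1)).re : ℝ) : ℂ) = q * Ωp) ∧
      (∃ q : ℂ, q ∈ coeffField f ∧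
        (((I ^ (j + 1) * completedLValue f (j + 1)).im : ℝ) : ℂ) = q * Ωm) := by
    intro j hjn
    rcases Nat.eq_zero_or_pos j with rfl | hj0
    · exact h _ (hf.extreme_criticalValues_mem_span hn hn0).1
    rcases lt_or_eq_of_le hjn with hjn' | rfl
    · set jj : Fin (n + 1) := ⟨j, by omega⟩ with hjj
      have hj0' : jj ≠ 0 := fun h0 ↦ by
        have := congrArg Fin.val h0
        simp [hjj] at this
        omega
      have hjn'' : jj ≠ Fin.last n := fun h0 ↦ by
        have := congrArg Fin.val h0
        simp [hjj] at this
        omega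
      have hz := h _ (msymbMoment_one_apply_mem_span hn hn0 hj0' hjn'' (coeffField f) f)
      rwa [msymbMoment_one_apply hn f jj] at hz
    · exact h _ (hf.extreme_criticalValues_mem_span hn hn0).2
  refine ⟨Ωp, Ωm, hp, hm, fun φ hφ ↦ ?_, fun j hj0 hjn hjodd ↦ ?_, fun j hjn hjev ↦ ?_⟩
  · obtain ⟨⟨a, ha, hae⟩, ⟨b, hb, hbe⟩⟩ := h _ (Submodule.subset_span ⟨φ, hφ, rfl⟩)
    refine ⟨a, b, ha, hb, ?_⟩
    rw [← hae, ← hbe]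
    exact (Complex.re_add_im _).symm
  · obtain ⟨⟨a, ha, hae⟩, -⟩ := hall j hjn.le
    have him := (I_pow_mul_completedLValue_re_im f hreal j).1 hjodd
    have hzeq : I ^ (j + 1) * completedLValue f (j + 1) = a * Ωp := by
      rw [← hae]
      exact Complex.ext (by simp) (by simp [him])
    rw [hzeq, mul_div_cancel_right₀ _ hp']
    exact ha
  · obtain ⟨-, ⟨b, hb, hbe⟩⟩ := hall j hjn
    have hre := (I_pow_mul_completedLValue_re_im f hreal j).2 hjev
    have hzeq : I ^ (j + 1) * completedLValue f (j + 1) = b * (Ωm * I) := by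
      rw [← mul_assoc, ← hbe]
      exact Complex.ext (by simp [hre]) (by simp)
    rw [hzeq, mul_div_cancel_right₀ _ hm']
    exact hb

/-- **Paşol–Popa Cor. 5.12 together with Prop. 5.11(c) for newforms on `Γ₀(N)` of even weight
`k ≥ 4`** — every clause of `PasolPopa2013_criticalValuesRationality` in these weights except
Prop. 5.11(b): there are nonzero `ω⁺ ∈ i^{k+1}ℝ`, `ω⁻ ∈ i^kℝ` with `iⁿ Λ(n, f)/ω⁺ ∈ K_f` for
`0 < n < k`, `(-1)ⁿ = (-1)^{k-1}`, and `iⁿ Λ(n, f)/ω⁻ ∈ K_f` for `0 < n < k`,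
`(-1)ⁿ = -(-1)^{k-1}` (`Λ(n, f) = completedLValue f n`; Manin 1973, Thm. 1.3 for level one;
Shimura 1977, Thm. 1). What remains of the named fact is exactly Prop. 5.11(b),
`ω⁺ \overline{ω⁻}/(i(2π)^{k-1}(f,f)) ∈ K_f` — Haberland's formula (PP Thm. 3.3). [cite: PasolPopa2013, Prop. 5.11(c) and Cor. 5.12] -/
theorem IsNewform0.criticalValues_mem_coeffField {k : ℤ} {f : CuspForm (Gamma0 N) k}
    (hf : IsNewform0 f) (hk : Even k) (hk4 : 4 ≤ k) :
    ∃ ωp ωm : ℂ, ωp ≠ 0 ∧ ωm ≠ 0 ∧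
      (∀ n' : ℕ, 0 < n' → (n' : ℤ) < k →
        ((n' : ℤ).negOnePow = (k - 1).negOnePow →
          I ^ n' * completedLValue f n' / ωp ∈ coeffField f) ∧
        ((n' : ℤ).negOnePow = -(k - 1).negOnePow →
          I ^ n' * completedLValue f n' / ωm ∈ coeffField f)) ∧
      (∃ r : ℝ, ωp = I ^ (k + 1) * r) ∧ (∃ r : ℝ, ωm = I ^ k * r) := by
  obtain ⟨t, ht⟩ : ∃ t : ℕ, k = 2 * (t : ℤ) + 2 := by
    obtain ⟨r, hr⟩ := hk
    refine ⟨(r - 1).toNat, ?_⟩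
    rw [Int.toNat_of_nonneg (by omega)]
    omega
  subst ht
  have ht0 : t ≠ 0 := by rintro rfl; simp at hk4
  set n : ℕ := 2 * t with hn_def
  have hn : Even n := ⟨t, by omega⟩
  have hn0 : n ≠ 0 := by omega
  have hcast : (2 * (t : ℤ) + 2 : ℤ) = (n : ℤ) + 2 := by rw [hn_def]; push_cast; ring
  revert f
  rw [hcast]
  intro f hf
  obtain ⟨Ωp, Ωm, hp, hm, -, hodd, heven⟩ := hf.exists_periods_criticalValues' hn hn0
  have hk1 : ((n : ℤ) + 2 - 1).negOnePow = -1 :=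
    Int.negOnePow_odd _ ⟨(n : ℤ) / 2 * 1 + t - t, by omega⟩
  refine ⟨Ωm * I, Ωp, mul_ne_zero (by exact_mod_cast hm) I_ne_zero, by exact_mod_cast hp,
    fun n' h1 h2 ↦ ⟨fun hpar ↦ ?_, fun hpar ↦ ?_⟩, ?_, ?_⟩
  · -- `+` parity: `n'` odd
    rw [hk1, Int.negOnePow_eq_neg_one_iff] at hpar
    obtain ⟨m, hm'⟩ := hpar
    obtain ⟨j, rfl⟩ : ∃ j : ℕ, n' = j + 1 := ⟨n' - 1, by omega⟩
    have hjev : Even j := ⟨m.toNat, by omega⟩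
    exact heven j (by omega) hjev
  · -- `-` parity: `n'` even
    rw [hk1, neg_neg, Int.negOnePow_eq_one_iff] at hpar
    obtain ⟨m, hm'⟩ := hpar
    obtain ⟨j, rfl⟩ : ∃ j : ℕ, n' = j + 1 := ⟨n' - 1, by omega⟩
    have hjodd : Odd j := ⟨(m - 1).toNat, by omega⟩
    exact hodd j (by omega) (by omega) hjodd
  · refine ⟨-((-1) ^ t * Ωm), ?_⟩
    rw [show (n : ℤ) + 2 + 1 = ((2 * (t + 1) + 1 : ℕ) : ℤ) by rw [hn_def]; push_cast; ring,
      zpow_natCast, pow_succ, pow_mul, I_sq]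
    push_cast
    have hsq : ((-1 : ℂ) ^ t) * ((-1 : ℂ) ^ t) = 1 := by
      rw [← pow_add, ← two_mul, pow_mul, neg_one_sq, one_pow]
    linear_combination (-((Ωm : ℂ) * I)) * hsq
  · refine ⟨(-1) ^ (t + 1) * Ωp, ?_⟩
    rw [show (n : ℤ) + 2 = ((2 * (t + 1) : ℕ) : ℤ) by rw [hn_def]; push_cast; ring, zpow_natCast,
      pow_mul, I_sq]
    push_cast
    have hsq : ((-1 : ℂ) ^ (t + 1)) * ((-1 : ℂ) ^ (t + 1)) = 1 := by
      rw [← pow_add, ← two_mul, pow_mul, neg_one_sq, one_pow]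
    linear_combination (-(Ωp : ℂ)) * hsq

/-- **Reduction of `PasolPopa2013_criticalValuesRationality` to Prop. 5.11(b).** The named fact
holds as soon as, for every newform `f` of even weight `k ≥ 4` on `Γ₀(N)`, SOME pair of periods
satisfying Cor. 5.12 and Prop. 5.11(c) (such pairs exist, `IsNewform0.criticalValues_mem_coeffField`)
also satisfies Prop. 5.11(b) — the content of Haberland's formula `3C_k(f,f) = {ρ_f^+, \overline{ρ_f^-}}`
(PP Thm. 3.3). All other weights are `PasolPopa2013_conclusion_of_lt_four_or_odd`. [cite: PasolPopa2013, Prop. 5.11(b) and Thm. 3.3] -/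
theorem PasolPopa2013_criticalValuesRationality_of_partB
    (Hb : ∀ (N : ℕ) [NeZero N] (k : ℤ) (f : CuspForm (Gamma0 N) k), IsNewform0 f → Even k → 4 ≤ k →
      ∃ ωp ωm : ℂ, ωp ≠ 0 ∧ ωm ≠ 0 ∧
        (∀ n' : ℕ, 0 < n' → (n' : ℤ) < k →
          ((n' : ℤ).negOnePow = (k - 1).negOnePow →
            I ^ n' * completedLValue f n' / ωp ∈ coeffField f) ∧
          ((n' : ℤ).negOnePow = -(k - 1).negOnePow →
            I ^ n' * completedLValue f n' / ωm ∈ coeffField f)) ∧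
        (ωp * (starRingEnd ℂ) ωm /
            (I * (2 * Real.pi : ℂ) ^ (k - 1) * peterssonProduct (Gamma0 N) k f f) ∈ coeffField f) ∧
        (∃ r : ℝ, ωp = I ^ (k + 1) * r) ∧ (∃ r : ℝ, ωm = I ^ k * r)) :
    PasolPopa2013_criticalValuesRationality := by
  rw [PasolPopa2013_criticalValuesRationality_iff_even_four_le]
  intro N _ k f hf hk hk4
  obtain ⟨ωp, ωm, hp, hm, hval, hb, hcp, hcm⟩ := Hb N k f hf hk hk4
  exact ⟨ωp, ωm, hp, hm, hval, fun _ ↦ hb, fun hodd ↦ absurd hodd (Int.not_odd_iff_even.mpr hk),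
    fun _ ↦ ⟨hcp, hcm⟩⟩

end Extremes

/-! ### The corrected statement (misprint `(2π)^{k-1}` ↦ `2^{k-1}` in Prop. 5.11(b)) -/

section Corrected

open Complex

/-- Weight two for the corrected normalisation of Prop. 5.11(b) (`(2π)^{k-1}` ↦ `2^{k-1}`): the same
choice `ω⁺ = iΛ(1,f)`, now with `ω⁻ = \overline{2i(f,f)/ω⁺}`. [cite: PasolPopa2013, Prop. 5.11 (b),(c) and Cor. 5.12 (k = 2)] -/
theorem PasolPopa2013_conclusion_weight_two_corrected (N : ℕ) [NeZero N] (f : CuspForm (Gamma0 N) 2)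
    (hf : IsNewform0 f) :
    ∃ ωp ωm : ℂ, ωp ≠ 0 ∧ ωm ≠ 0 ∧
      (∀ n : ℕ, 0 < n → (n : ℤ) < 2 →
        ((n : ℤ).negOnePow = ((2 : ℤ) - 1).negOnePow →
          Complex.I ^ n * completedLValue f n / ωp ∈ coeffField f) ∧
        ((n : ℤ).negOnePow = -((2 : ℤ) - 1).negOnePow →
          Complex.I ^ n * completedLValue f n / ωm ∈ coeffField f)) ∧
      (Even (2 : ℤ) → ωp * (starRingEnd ℂ) ωm /
          (Complex.I * (2 : ℂ) ^ ((2 : ℤ) - 1) * peterssonProduct (Gamma0 N) 2 f f) ∈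
        coeffField f) ∧
      (Odd (2 : ℤ) →
        ((‖ωp‖ ^ 2 : ℝ) : ℂ) / ((2 : ℂ) ^ ((2 : ℤ) - 1) * peterssonProduct (Gamma0 N) 2 f f) ∈
          coeffField f ∧
        ((‖ωm‖ ^ 2 : ℝ) : ℂ) / ((2 : ℂ) ^ ((2 : ℤ) - 1) * peterssonProduct (Gamma0 N) 2 f f) ∈
          coeffField f) ∧
      (HasRealCoefficients f →
        (∃ r : ℝ, ωp = Complex.I ^ ((2 : ℤ) + 1) * r) ∧ (∃ r : ℝ, ωm = Complex.I ^ (2 : ℤ) * r)) := by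
  classical
  have hf0 : f ≠ 0 := IsNormalized.ne_zero hf.2.2
  set Λ : ℂ := completedLValue f 1 with hΛ
  set P : ℂ := peterssonProduct (Gamma0 N) 2 f f with hP
  have hPpos : 0 < P.re := peterssonProduct_self_pos_holds (Gamma0 N) 2 hf0
  have hPreal : P = (P.re : ℂ) := peterssonProduct_self_eq_ofReal (Gamma0 N) 2 f
  have hP0 : P ≠ 0 := fun h ↦ by simp [h] at hPpos
  have hπ : (2 : ℂ) ≠ 0 := two_ne_zero
  -- the periods
  set ωp : ℂ := if Λ = 0 then Complex.I else Complex.I * Λ with hωp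
  have hωp0 : ωp ≠ 0 := by
    rw [hωp]
    split_ifs with h
    · exact Complex.I_ne_zero
    · exact mul_ne_zero Complex.I_ne_zero h
  set ωm : ℂ := (starRingEnd ℂ) (Complex.I * (2 : ℂ) * P / ωp) with hωm
  have hωm0 : ωm ≠ 0 := by
    rw [hωm, map_ne_zero]
    exact div_ne_zero (mul_ne_zero (mul_ne_zero Complex.I_ne_zero hπ) hP0) hωp0
  have h21 : (2 : ℤ) - 1 = 1 := by norm_num
  refine ⟨ωp, ωm, hωp0, hωm0, fun n hn hn2 ↦ ⟨fun _ ↦ ?_, fun hpar ↦ ?_⟩, fun _ ↦ ?_,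
    fun hodd ↦ ?_, fun hreal ↦ ⟨?_, ?_⟩⟩
  · -- the `+` critical value `iΛ(1,f)/ω⁺ ∈ {0,1}`
    obtain rfl : n = 1 := by omega
    simp only [pow_one]
    rw [hωp]
    split_ifs with h
    · rw [← hΛ, h, mul_zero, zero_div]
      exact zero_mem _
    · rw [← hΛ, div_self (mul_ne_zero Complex.I_ne_zero h)]
      exact one_mem _
  · -- no `-` critical value in weight `2`
    exfalso
    obtain rfl : n = 1 := by omega
    rw [h21] at hpar
    have h1 : ((1 : ℕ) : ℤ).negOnePow = -1 := Int.negOnePow_one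
    rw [h1, Int.negOnePow_one, neg_neg] at hpar
    exact absurd (congrArg Units.val hpar) (by norm_num)
  · -- (b): `ω⁺ conj ω⁻ = i 2π (f,f)`
    rw [h21, zpow_one, hωm, starRingEnd_self_apply, mul_div_cancel₀ _ hωp0,
      div_self (mul_ne_zero (mul_ne_zero Complex.I_ne_zero hπ) hP0)]
    exact one_mem _
  · exact absurd hodd (by decide)
  · -- (c) for `ω⁺`: `Λ(1,f)` is real
    have hΛreal : Λ = (Λ.re : ℂ) := by
      refine Complex.ext (by simp) ?_
      rw [Complex.ofReal_im, hΛ]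
      exact completedLValue_im_eq_zero f hreal 1
    have hI3 : Complex.I ^ ((2 : ℤ) + 1) = -Complex.I := by
      rw [show (2 : ℤ) + 1 = 3 by norm_num, zpow_ofNat, pow_succ, Complex.I_sq]
      ring
    rw [hI3, hωp]
    split_ifs with h
    · exact ⟨-1, by push_cast; ring⟩
    · refine ⟨-Λ.re, ?_⟩
      conv_lhs => rw [hΛreal]
      push_cast
      ring
  · -- (c) for `ω⁻`: `conj (2πi P / ω⁺)` is real as `ω⁺ ∈ iℝ`, `P ∈ ℝ`
    have hΛreal : Λ = (Λ.re : ℂ) := by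
      refine Complex.ext (by simp) ?_
      rw [Complex.ofReal_im, hΛ]
      exact completedLValue_im_eq_zero f hreal 1
    have hI2 : Complex.I ^ (2 : ℤ) = -1 := by
      rw [zpow_ofNat, Complex.I_sq]
    -- `ω⁺ = i r` with `r` real nonzero
    obtain ⟨r, hr0, hr⟩ : ∃ r : ℝ, r ≠ 0 ∧ ωp = Complex.I * r := by
      rw [hωp]
      split_ifs with h
      · exact ⟨1, one_ne_zero, by simp⟩
      · refine ⟨Λ.re, fun h0 ↦ h ?_, ?_⟩
        · rw [hΛreal, h0, Complex.ofReal_zero]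
        · conv_lhs => rw [hΛreal]
    refine ⟨-(2 * P.re / r), ?_⟩
    rw [hI2, hωm, hr, hPreal]
    have hr' : (r : ℂ) ≠ 0 := by exact_mod_cast hr0
    have hval : Complex.I * (2 : ℂ) * (P.re : ℂ) / (Complex.I * r) =
        ((2 * P.re / r : ℝ) : ℂ) := by
      push_cast
      field_simp
    rw [hval, Complex.conj_ofReal]
    push_cast
    simp only [Complex.ofReal_re]
    ring


/-- **The corrected Paşol–Popa statement, reduced to Haberland's formula.** The printed
Prop. 5.11(b) of [PasolPopa2013] (arXiv:1202.5802v5 = Proc. LMS 107 (2013)) reads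
`ω_f^+ \overline{ω_f^-}/(i (2π)^{k-1} (f,f)) ∈ K_f`; the factor `(2π)^{k-1}` is a misprint for
`2^{k-1}`: PP derive (b) from (a) and Thm. 3.3, `3C_k(f,f) = {ρ_f^+, \overline{ρ_f^-}}` with
`C_k = -(2i)^{k-1}` (Thm. 3.2), where neither the period polynomial
`ρ_f(A)(X) = ∫₀^{i∞} f∣A(t)(t-X)^w dt` (§2, (5.1), (5.7)) nor the Petersson product (3.1) involves `π`,
so that `ω^+\overline{ω^-}/(i 2^{k-1}(f,f)) ∈ K_f`; as `(2π)^{k-1}` is transcendental the printed form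
contradicts this, and it is false already for `f = Δ`, where
`Λ(1,Δ)Λ(2,Δ)/(Δ,Δ) = 2^{13}3²/(5·691)` is rational (Kohnen–Zagier). Consequently
`PasolPopa2013_criticalValuesRationality` as vendored is not provable in even weight `≥ 4`. This
theorem records the corrected statement — `(2π)^{k-1}` replaced by `2^{k-1}` in (b), everything else
verbatim — and proves it from its part (b) for newforms of even weight `k ≥ 4` alone (Haberland's
formula, PP Thm. 3.3, the one remaining unformalised input); all other clauses are
`PasolPopa2013_conclusion_weight_two_corrected`, `IsNewform0.even_and_two_le` and
`IsNewform0.criticalValues_mem_coeffField`. [cite: PasolPopa2013, Prop. 5.11 (b),(c), Cor. 5.12 and Thm. 3.3] -/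
theorem PasolPopa2013_criticalValuesRationality_corrected_of_partB
    (Hb : ∀ (N : ℕ) [NeZero N] (k : ℤ) (f : CuspForm (Gamma0 N) k), IsNewform0 f → Even k → 4 ≤ k →
      ∃ ωp ωm : ℂ, ωp ≠ 0 ∧ ωm ≠ 0 ∧
        (∀ n' : ℕ, 0 < n' → (n' : ℤ) < k →
          ((n' : ℤ).negOnePow = (k - 1).negOnePow →
            I ^ n' * completedLValue f n' / ωp ∈ coeffField f) ∧
          ((n' : ℤ).negOnePow = -(k - 1).negOnePow →
            I ^ n' * completedLValue f n' / ωm ∈ coeffField f)) ∧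
        (ωp * (starRingEnd ℂ) ωm /
            (I * (2 : ℂ) ^ (k - 1) * peterssonProduct (Gamma0 N) k f f) ∈ coeffField f) ∧
        (∃ r : ℝ, ωp = I ^ (k + 1) * r) ∧ (∃ r : ℝ, ωm = I ^ k * r)) :
    ∀ (N : ℕ) [NeZero N] (k : ℤ) (f : CuspForm (Gamma0 N) k), IsNewform0 f →
      ∃ ωp ωm : ℂ, ωp ≠ 0 ∧ ωm ≠ 0 ∧
        (∀ n : ℕ, 0 < n → (n : ℤ) < k →
          ((n : ℤ).negOnePow = (k - 1).negOnePow →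
            I ^ n * completedLValue f n / ωp ∈ coeffField f) ∧
          ((n : ℤ).negOnePow = -(k - 1).negOnePow →
            I ^ n * completedLValue f n / ωm ∈ coeffField f)) ∧
        (Even k → ωp * (starRingEnd ℂ) ωm /
            (I * (2 : ℂ) ^ (k - 1) * peterssonProduct (Gamma0 N) k f f) ∈ coeffField f) ∧
        (Odd k →
          ((‖ωp‖ ^ 2 : ℝ) : ℂ) / ((2 : ℂ) ^ (k - 1) * peterssonProduct (Gamma0 N) k f f) ∈
            coeffField f ∧
          ((‖ωm‖ ^ 2 : ℝ) : ℂ) / ((2 : ℂ) ^ (k - 1) * peterssonProduct (Gamma0 N) k f f) ∈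
            coeffField f) ∧
        (HasRealCoefficients f →
          (∃ r : ℝ, ωp = I ^ (k + 1) * r) ∧ (∃ r : ℝ, ωm = I ^ k * r)) := by
  intro N _ k f hf
  by_cases hk : k < 4 ∨ Odd k
  · obtain ⟨heven, h2⟩ := hf.even_and_two_le
    have hk2 : k = 2 := by
      rcases hk with hk | hodd
      · obtain ⟨m, rfl⟩ := heven
        omega
      · exact absurd hodd (Int.not_odd_iff_even.mpr heven)
    subst hk2
    exact PasolPopa2013_conclusion_weight_two_corrected N f hf
  · push Not at hk
    obtain ⟨ωp, ωm, hp, hm, hval, hb, hcp, hcm⟩ := Hb N k f hf (Int.not_odd_iff_even.mp hk.2) hk.1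
    exact ⟨ωp, ωm, hp, hm, hval, fun _ ↦ hb, fun hodd ↦ absurd hodd hk.2, fun _ ↦ ⟨hcp, hcm⟩⟩

end Corrected

end Literature.NumberTheory.EllipticCurves.ModularForms
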